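import Mathlib.Analysis.SpecificLimits.Basic
import Literature.Probability.Percolation.SmirnovRSW
import Literature.Probability.Percolation.TriSharpness
import Literature.Probability.Percolation.TriRSWChaining
import HarnessLib

/-!
# RSW at `p = 1/2`, `θ(1/2) = 0`, `p_c^site(𝕋) = 1/2` and box crossings for site percolation on `𝕋`

Topic `Literature/Probability/Percolation`. Discharge of the named facts
`Literature.Probability.Percolation.triTheta_half` (`θ^site_𝕋(1/2) = 0`), `Literature.Probability.Percolation.triCriticalProb_eq_half`
(`p_c^site(𝕋) = 1/2`) and `Literature.Probability.Percolation.tri_rsw_half` (the RSW box-crossing property at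
`p = 1/2`) of `BoxCrossing.lean` (Kesten, *Percolation theory for mathematicians*
(1982), §3.4, Application (i), (3.67) with Thm. 3.1 (3.43), p. 53; Bollobás–Riordan,
*Percolation* (2006), Ch. 5, Thm. 8; Grimmett, *Probability on Graphs* (2018), Thm. 5.56).

## Part I: RSW doubling and iteration (Grimmett 2018, Lemmas 5.20, 5.22, eq. (5.21))

Conclusion of Smirnov's RSW lemma (`SmirnovRSW.lean`), def-free. In the brick coordinates of
`BrickHex.lean` write `h(a, b) = P_{1/2}(H({1 ≤ X ≤ 2a} × {1 ≤ Y ≤ b}))`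
(`brickHProb half 1 (2a) 1 b`, Grimmett's `P(H_{a, ·})` up to the parametrisation of the
Euclidean rectangle).

* `A'ev_inter_A''ev_subset_brickHEvent` — a black path from the left edge to `ρJ_b` and one from
  the right edge to `J_b` together contain a horizontal crossing of the doubled rectangle
  (Grimmett: "`P(H_{2a,b}) ≥ P(L ↔ ρJ_b, R ↔ J_b)`"; two padding devices for the case where the
  paths end on the bottom row);
* `rsw_doubling` — **`h(2a, b) ≥ h(a, b)² / 4`** (Grimmett 2018, Lemma 5.20): Harris–FKG for the
  two increasing events, reflection symmetry `P(R ↔ J_b) = P(L ↔ ρJ_b)`, and the conditioning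
  step `half_brickHProb_le_real_A'ev` (`SmirnovRSW.lean`);
* `half_le_brickHProb_base` — **`h(a, 2a + 1) ≥ 1/2`** (Grimmett 2018, Lemma 5.22): a left–right
  crossing of the rhombus `R(2a, 2a)` (probability `1/2`, `triLRCrossingProb_half_self`) crosses
  the brick rectangle `{2a ≤ X ≤ 4a - 1} × {0 ≤ Y ≤ 2a}`;
* `rsw_iterate` — **`h(2^k a, 2a + 1) ≥ 4 · 8^{-2^k}`** for all `k` and `a ≥ 1` (Grimmett 2018,
  (5.21): `P(H_{2^k a, b}) ≥ 4 [P(H_{a,b}) / 4]^{2^k}`).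

## Part II: `θ(1/2) = 0` (Werner 2009, Lemma 1.2, Cor. 1.2) and `p_c = 1/2`

The proof of `θ(1/2) = 0` is the RSW argument of Werner, *Lectures on two-dimensional critical
percolation* (2009), §1, Lemma 1.2 and Corollary 1.2 ("if well-chosen rotated rectangles are
crossed by a closed path then there is a closed circuit in the annulus `A_j`; the annuli are
independent, so `P(∂Λ_{2^j} ⟷ ∂Λ_{2^{j+l}}) ≤ (1 - a^6)^l`"), in the following square-annulus
form, whose only planar-topological input is the Hex lemma for brick rectangles
(`brick_hex_excl'`, `BrickHex.lean`):

* `brickV_of_pathIn` — a `𝕋`-path from below row `Y₀` to row `Y₁` inside a region whose sites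
  have brick coordinate in `[X₀, X₁]` and row `≤ Y₁` contains a vertical crossing of the brick
  rectangle `[X₀, X₁] × [Y₀, Y₁]`;
* `not_pathIn_of_annulus` — **blocking**: if the strip
  `S_a = {|X| ≤ 9a + 3} × {a + 1 ≤ Y ≤ 3a + 1}` has a white horizontal crossing in each of the
  four configurations `ω`, `-ω`, `ωᵗ`, `(-ω)ᵗ` (central inversion and transposition are
  automorphisms of `𝕋`: `triGraph_adj_neg`, `TriRSWChaining.lean`, and `triGraph_adj_transposeIso`,
  `TriHexLemma.lean`), then no black path
  joins `0` to the outside of the box `Λ(3a + 1) = [-(3a+1), 3a+1]²`: its first exit from the box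
  crosses one of the four strips the short way, contradicting `brick_hex_excl'`;
* `le_real_annulusEvent` — by RSW (`rsw_iterate` with `k = 4`: the `32a × (2a + 1)` brick
  rectangle is crossed the long way with probability `≥ c := 4 · 8⁻¹⁶` at `p = 1/2`),
  translation/width monotonicity, the invariance of `P_{1/2}` under the two automorphisms and
  Harris' inequality, the black version of the four-strip event has probability `≥ c⁴`; it is
  increasing and determined by the annulus `Λ(6a + 2) ∖ Λ(a)`;
* `real_biInter_compl_eq_prod` — events determined by pairwise disjoint finite sets are
  independent: `P(⋂_{j<k} A_jᶜ) = ∏_{j<k} (1 - P(A_j))`;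
* `triTheta_half_le_pow` — with the scales `a_j = 8^j` (disjoint annuli) and the symmetry
  `P_{1/2}(ωᶜ ∈ ·) = P_{1/2}`: `θ(1/2) ≤ P_{1/2}(0 ⟷ ∂Λ(8^k)) ≤ (1 - c⁴)^k` for every `k`, whence
  **`triTheta_half_holds : θ(1/2) = 0`** and, with `triCriticalProb_eq_half_of_triTheta_half`
  (`TriSharpness.lean`, the sharpness half `p_c ≤ 1/2`), **`triCriticalProb_eq_half_holds`**.

## Part III: the box-crossing property `tri_rsw_half` (Kesten 1982, §3.4; Werner 2009, Cor. 1.1)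

`tri_rsw_half`: for every aspect ratio `ρ > 0` there is
`c = c(ρ) > 0` with `c ≤ P_{1/2}(LR_𝕋(⌊ρ n⌋, n)) ≤ 1 - c` for all `n` with `⌊ρ n⌋ ≥ 1`, where
`LR_𝕋(m, n)` is the left–right site crossing of the lattice parallelogram `R(m, n) = [0, m] × [0, n]`
(Kesten 1982, §3.4; Russo 1981; Werner 2009, Cor. 1.1: "For any `k`, there exists
`a_k > 0` such that `P(H(kn, n)) ≥ a_k` for any `n > 2`", and §1.4 "A remark about tightness":
"there exists `ε > 0` such that for any `n`, `ε < P(H(2n, n)) < 1 - ε`"; Grimmett 2018,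
Thm. 5.23). We derive it from the RSW theory for *brick* (Euclidean) rectangles of Part I
(`rsw_iterate`) and the Hex duality of the parallelogram (`triLRCrossingProb_add_eq_one`,
`TriHexExclusive.lean`):

* `triLRCrossing_of_brickH` — a black horizontal crossing of the brick rectangle
  `{0 ≤ X ≤ 2m + n} × {0 ≤ Y ≤ n}` (brick coordinates `X = 2x₀ + x₁`, `Y = x₁`) contains a
  left–right crossing of `R(m, n)` (`x₀ = (X - Y)/2` moves by at most `1` along an edge: cut at
  the last visit to `{x₀ ≤ 0}` and the first visit to `{x₀ ≥ m}`);
* `le_triLRCrossingProb` — **lower bound**: for `1 ≤ m ≤ K n` and `n ≥ 2`,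
  `P_{1/2}(LR_𝕋(m, n)) ≥ 4 · 8^{-2^{K+3}}`: the `2^{K+4} a × (2a + 1)` brick rectangle of
  `rsw_iterate`, `a = ⌊n/2⌋`, translated to start at `(0, 0)`, is wider than `2m + n` and not
  taller than `n` (`brickHProb_shift`, `brickHProb_antitone`, `BrickH.of_rows`);
* `triLRCrossingProb_half_eq_one_sub` — **duality** `P_{1/2}(LR(m, n)) = 1 - P_{1/2}(LR(n, m))`,
  so the upper bound is the lower bound for the transposed parallelogram;
* `triLRCrossingProb_pos` — `P_p(LR(m, n)) ≥ p^{|R(m, n)|} > 0` (all sites open), used for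
  the finitely many small `n` not covered by the generic bounds;
* `tri_rsw_half_holds` — the assembly, with `K = ⌈ρ⌉`, `K' = ⌈2/ρ⌉` and the small cases
  `n ≤ ⌈2/ρ⌉ + 2` absorbed into the constant by a finite minimum.

## References

* H. Kesten, *Percolation theory for mathematicians*, Birkhäuser 1982, §3.4, Application (i),
  (3.67) with Thm. 3.1 (3.43), p. 53 [KestenPTM1982].
* W. Werner, *Lectures on two-dimensional critical percolation*, IAS/Park City Math. Ser. 16
  (2009), §1, Lemma 1.2, Corollary 1.2 [Werner2009].
* G. Grimmett, *Probability on Graphs*, 2nd ed. (2018), §5.5 (Lemma 5.20, Thm. 5.23) and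
  Thm. 5.56 [Grimmett2018].
* B. Bollobás, O. Riordan, *Percolation*, CUP 2006, Ch. 5, Lemma 7 and Thm. 8 [BollobasRiordan2006].

## Mathlib / tree

Mathlib: `Equiv.neg`, `Set.image_compl_eq`, `Set.image_inter_preimage`,
`tendsto_pow_atTop_nhds_zero_of_lt_one`, `ge_of_tendsto'`, `probReal_compl_eq_one_sub`.
Tree: `BrickH`, `BrickV`, `brickRect`, `brick_hex_excl'`, `row_adj_le` (`BrickHex.lean`),
`brickHEvent`, `brickHProb`, `brickHProb_shift`, `brickHProb_antitone`,
`determinedBy_brickHEvent`, `isUpperSet_brickHEvent`, `triGraph_adj_iff_brick`,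
`triSitePercolation_half_real_preimage_compl` (`BrickHex.lean`), `half_brickHProb_le_real_A'ev`
(`SmirnovRSW.lean`), `sitePercolation_harris`, `triLRCrossingProb_half_self` (`TriHexExclusive.lean`), `triGraph_adj_transposeIso`, `triGraph_adj_coord` (`TriHexLemma.lean`), `triGraph_adj_neg`
(`TriRSWChaining.lean`, whose closed frames `triClosedFrame` of parallelogram strips are the
analogue of the brick four-strip event used here),
`transposeIso` (`LatticeSymmetry.lean`), `PathIn` (`SitePaths.lean`), `exitEvent`,
`sitePercolatesAt_subset_exitEvent`, `DeterminedBy.iInter`, `DeterminedBy.compl`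
(`SiteMonotonicity.lean`), `isUpperSet_preimage_relabel`, `determinedBy_preimage_relabel`
(`TriShiftedCrossings.lean`), `sitePercolation_harris`, `sitePercolation_real_inter_of_disjoint`,
`sitePercolation_real_preimage_relabel`, `SiteConfig.relabel` (`SitePercolationMeasure.lean`),
`box` (`ThermodynamicLimit.lean`), `triTheta_eq` (`TriangularLattice.lean`),
`triCriticalProb_eq_half_of_triTheta_half` (`TriSharpness.lean`), `triLRCrossingProb_add_eq_one`
(`TriHexExclusive.lean`), `sitePercolation_real_subset` (`SitePercolationMeasure.lean`), `rectangle`,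
`leftSide`, `rightSide` (`Crossings.lean`), `tri_rsw_half` (`BoxCrossing.lean`).
-/

noncomputable section

open MeasureTheory Filter Topology

namespace Literature.Probability.Percolation

/-! ### Horizontal crossings extracted from paths -/

/-- **Extraction of a horizontal crossing**: a path of sites of `B` inside a region `A` whose
sites with `X₀ ≤ X ≤ X₁` lie in the brick rectangle, from `{X ≤ X₀ + 1}` to `{X₁ - 1 ≤ X}`,
contains a horizontal crossing of the brick rectangle (`X` moves by at most `2` along an edge).
[cite: Grimmett2018, Lemma 5.22 (proof)] -/
theorem brickH_of_pathIn {A B : Set (LatticeModels.Site 2)} {X₀ X₁ Y₀ Y₁ : ℤ} {x y : LatticeModels.Site 2}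
    (hxy : PathIn LatticeModels.triGraph (A ∩ B) x y) (hx : brickX x ≤ X₀ + 1) (hy : X₁ ≤ brickX y + 1)
    (hX : X₀ + 1 ≤ X₁)
    (hA : ∀ z ∈ A, X₀ ≤ brickX z → brickX z ≤ X₁ → z ∈ brickRect X₀ X₁ Y₀ Y₁) :
    BrickH B X₀ X₁ Y₀ Y₁ := by
  let C : Set (LatticeModels.Site 2) := {z | brickX z < X₀}
  have hyC : y ∉ C := by simp only [C, Set.mem_setOf_eq, not_lt]; omega
  obtain ⟨b, hb₀, hb₁, hby⟩ : ∃ b, X₀ ≤ brickX b ∧ brickX b ≤ X₀ + 1 ∧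
      PathIn LatticeModels.triGraph ((A ∩ B) \ C) b y := by
    rcases hxy.after_last_exit hyC with h1 | ⟨a, b, haC, -, hbC, hab, hby⟩
    · have hxC : ¬ brickX x < X₀ := h1.left_mem.2
      exact ⟨x, not_lt.1 hxC, hx, h1⟩
    · have haC' : brickX a < X₀ := haC
      have hbC' : ¬ brickX b < X₀ := hbC
      exact ⟨b, not_lt.1 hbC', by have := (brickX_adj_le hab).1; omega, hby⟩
  have hsub : {z : LatticeModels.Site 2 | brickX z ≤ X₁} ∩ ((A ∩ B) \ C) ⊆ brickRect X₀ X₁ Y₀ Y₁ ∩ B := by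
    rintro z ⟨hz1, ⟨hzA, hzB⟩, hzC⟩
    have hz1' : brickX z ≤ X₁ := hz1
    have hzC' : ¬ brickX z < X₀ := hzC
    exact ⟨hA z hzA (not_lt.1 hzC') hz1', hzB⟩
  have hbR : b ∈ {z : LatticeModels.Site 2 | brickX z ≤ X₁} := by simp only [Set.mem_setOf_eq]; omega
  rcases hby.exit_or (R := {z : LatticeModels.Site 2 | brickX z ≤ X₁}) hbR with
    h2 | ⟨a', b', ha', hb', -, hab', hba'⟩
  · exact ⟨b, y, hb₁, hy, h2.mono hsub⟩
  · have ha'' : brickX a' ≤ X₁ := ha'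
    have hb'' : ¬ brickX b' ≤ X₁ := hb'
    exact ⟨b, a', hb₁, by have := (brickX_adj_le hab').1; omega, hba'.mono hsub⟩

namespace SmirnovRSW

variable {a b : ℕ}

/-! ### The events `A'`, `A''`: symmetry, monotonicity, locality -/

/-- `A''` is the mirror image of `A'`. [cite: Grimmett2018, Lemma 5.20 (proof)] -/
theorem relabel_rho_preimage_A'ev :
    SiteConfig.relabel (rho a) ⁻¹' A'ev a b = A''ev a b := by
  ext ω
  simp only [Set.mem_preimage, A'ev, A''ev, Set.mem_setOf_eq, SiteConfig.relabel_apply]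
  have hfull : ∀ S : Set (LatticeModels.Site 2), rho a '' (fullR a b ∩ S) = fullR a b ∩ rho a '' S := fun S => by
    ext z
    rw [mem_image_rho_iff, Set.mem_inter_iff, Set.mem_inter_iff, rho_mem_fullR_iff, mem_image_rho_iff]
  constructor
  · rintro ⟨x, y, hx, hy, hxy⟩
    have h := hxy.map_adj (rho a) fun _ _ h => adj_rho h
    rw [hfull, ← Set.image_comp] at h
    have hid : (rho a ∘ rho a) '' ω = ω := by
      rw [show ((rho a) ∘ (rho a) : LatticeModels.Site 2 → LatticeModels.Site 2) = id from funext fun z => rho_rho z,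
        Set.image_id]
    rw [hid] at h
    refine ⟨rho a x, rho a y, ?_, ?_, h⟩
    · rw [brickX_rho]; omega
    · rw [brickX_rho, rho_apply_one]; omega
  · rintro ⟨x, y, hx, hy, hxy⟩
    have h := hxy.map_adj (rho a) fun _ _ h => adj_rho h
    rw [hfull] at h
    refine ⟨rho a x, rho a y, ?_, ?_, h⟩
    · rw [brickX_rho]; omega
    · rw [brickX_rho, rho_apply_one]; omega

/-- **`P(R ↔ J_b) = P(L ↔ ρJ_b)`** (reflection symmetry). [cite: Grimmett2018, Lemma 5.20 (proof)] -/
theorem real_A''ev (p : unitInterval) :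
    (LatticeModels.triSitePercolation p).real (A''ev a b) = (LatticeModels.triSitePercolation p).real (A'ev a b) := by
  rw [← relabel_rho_preimage_A'ev, LatticeModels.triSitePercolation, sitePercolation_real_preimage_relabel]

/-- `A'` is increasing. [cite: Grimmett2018, Lemma 5.20 (proof)] -/
theorem isUpperSet_A'ev : IsUpperSet (A'ev a b) := by
  rintro ω ω' hle ⟨x, y, hx, hy, hxy⟩
  exact ⟨x, y, hx, hy, hxy.mono (Set.inter_subset_inter_right _ hle)⟩

/-- `A''` is increasing. [cite: Grimmett2018, Lemma 5.20 (proof)] -/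
theorem isUpperSet_A''ev : IsUpperSet (A''ev a b) := by
  rintro ω ω' hle ⟨x, y, hx, hy, hxy⟩
  exact ⟨x, y, hx, hy, hxy.mono (Set.inter_subset_inter_right _ hle)⟩

/-- `A'` is determined by the sites of `R'`. [cite: Grimmett2018, Lemma 5.20 (proof)] -/
theorem determinedBy_A'ev : DeterminedBy (A'ev a b) ↑(fullRfin a b) := by
  rw [determinedBy_iff]
  intro ω ω' h
  rw [coe_fullRfin] at h
  have : fullR a b ∩ ω = fullR a b ∩ ω' := by rw [Set.inter_comm, h, Set.inter_comm]
  simp only [A'ev, Set.mem_setOf_eq, this]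

/-- `A''` is determined by the sites of `R'`. [cite: Grimmett2018, Lemma 5.20 (proof)] -/
theorem determinedBy_A''ev : DeterminedBy (A''ev a b) ↑(fullRfin a b) := by
  rw [determinedBy_iff]
  intro ω ω' h
  rw [coe_fullRfin] at h
  have : fullR a b ∩ ω = fullR a b ∩ ω' := by rw [Set.inter_comm, h, Set.inter_comm]
  simp only [A''ev, Set.mem_setOf_eq, this]

/-! ### `A' ∩ A''` contains a horizontal crossing of `R'` -/

/-- **Crossing device**: a black path inside `R'` from the fat left edge to a bottom-row site
`y₁`, and a white vertical crossing of `R'` starting at a bottom-row site `s` to the left of `y₁`,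
cannot coexist. (Planar statement "the two paths must cross", proved by padding: the black path
extended through the left padding and along the bottom padding right of `s`, and the white path
extended into the top padding and to the bottom padding site left below `s`, would be a black
left–right and a white top–bottom crossing of the padding parallelogram.) [cite: Grimmett2018, Lemma 5.20 (proof)] -/
theorem not_cross_left (hb : 1 ≤ b) {ω : SiteConfig (LatticeModels.Site 2)} {x₁ y₁ s t : LatticeModels.Site 2}
    (hx₁ : brickX x₁ ≤ 2) (hy₁ : y₁ 1 = 1) (h₁ : PathIn LatticeModels.triGraph (fullR a b ∩ ω) x₁ y₁)
    (hs : s 1 = 1) (ht : t 1 = b) (hw : PathIn LatticeModels.triGraph (fullR a b ∩ ωᶜ) s t)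
    (hlt : brickX s < brickX y₁) : False := by
  -- black mass: left padding, black sites of `R'`, bottom padding right of `s`
  let blk : Set (LatticeModels.Site 2) := {z | 1 ≤ z 1 ∧ z 1 ≤ b ∧ brickX z ≤ 0} ∪ (fullR a b ∩ ω) ∪
    {z | z 1 = 0 ∧ brickX s + 1 ≤ brickX z}
  have memblk : ∀ {z : LatticeModels.Site 2}, z ∈ blk ↔ (1 ≤ z 1 ∧ z 1 ≤ b ∧ brickX z ≤ 0) ∨
      (z ∈ fullR a b ∧ z ∈ ω) ∨ (z 1 = 0 ∧ brickX s + 1 ≤ brickX z) := fun {z} => by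
    simp only [blk, Set.mem_union, Set.mem_setOf_eq, Set.mem_inter_iff, or_assoc]
  have hW : (((b + 1 : ℕ) : ℤ)) = (b : ℤ) + 1 := by push_cast; ring
  have hx₁R := mem_fullR.1 h₁.left_mem.1
  have hy₁R := mem_fullR.1 h₁.right_mem.1
  have hsR := mem_fullR.1 hw.left_mem.1
  have htR := mem_fullR.1 hw.right_mem.1
  ---------------------------------------------------------------- black left–right crossing
  -- from the left side of the padding parallelogram along the row of `x₁` to `x₁`
  obtain ⟨kx, hkx⟩ : ∃ k : ℕ, (k : ℤ) = x₁ 0 - pCorner b 0 :=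
    ⟨_, Int.toNat_of_nonneg (by rw [pCorner_zero]; simp only [brickX] at hx₁R; omega)⟩
  have hleft : PathIn LatticeModels.triGraph (Ppara a b ∩ blk) (x₁ - (kx : ℤ) • triE0) x₁ := by
    refine triPathIn_row_left kx fun j hj => ?_
    have hj' : (j : ℤ) ≤ kx := by exact_mod_cast hj
    rw [pCorner_zero] at hkx
    refine ⟨?_, ?_⟩
    · rw [mem_Ppara, sub_zsmul_triE0_apply_zero, sub_zsmul_triE0_apply_one]
      simp only [brickX] at hx₁R
      push_cast; omega
    · rcases Nat.eq_zero_or_pos j with rfl | hjpos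
      · simpa using memblk.2 (Or.inr (Or.inl ⟨h₁.left_mem.1, h₁.left_mem.2⟩))
      · refine memblk.2 (Or.inl ?_)
        rw [sub_zsmul_triE0_apply_one, brickX_sub_zsmul_triE0]
        omega
  -- from `y₁` down-right into the bottom padding and along it to the right side
  set c₁ : LatticeModels.Site 2 := y₁ + LatticeModels.triDiag with hc₁
  have hc₁0 : c₁ 0 = y₁ 0 + 1 := by simp [hc₁]
  have hc₁1 : c₁ 1 = 0 := by simp [hc₁, hy₁]
  have hXc₁ : brickX c₁ = brickX y₁ + 1 := by simp [hc₁, brickX]; ring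
  obtain ⟨ky, hky⟩ : ∃ k : ℕ, (k : ℤ) = pCorner b 0 + pWidth a b - c₁ 0 :=
    ⟨_, Int.toNat_of_nonneg (by
      rw [pCorner_zero, pWidth, hc₁0]; simp only [brickX] at hy₁R; push_cast; omega)⟩
  have hright : PathIn LatticeModels.triGraph (Ppara a b ∩ blk) c₁ (c₁ + (ky : ℤ) • triE0) := by
    refine triPathIn_row_right ky fun j hj => ?_
    have hj' : (j : ℤ) ≤ ky := by exact_mod_cast hj
    rw [pCorner_zero, pWidth, hc₁0] at hky
    push_cast at hky
    have hy0 : 0 ≤ y₁ 0 ∧ y₁ 0 ≤ 2 * a := by simp only [brickX] at hy₁R; omega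
    refine ⟨?_, memblk.2 (Or.inr (Or.inr ⟨by rw [add_zsmul_triE0_apply_one, hc₁1], ?_⟩))⟩
    · rw [mem_Ppara, add_zsmul_triE0_apply_zero, add_zsmul_triE0_apply_one, hc₁0, hc₁1]
      push_cast
      refine ⟨?_, ?_, trivial, ?_⟩
      · omega
      · omega
      · omega
    · rw [brickX_add_zsmul_triE0, hXc₁]; omega
  have hblack : PathIn LatticeModels.triGraph (Ppara a b ∩ blk) (x₁ - (kx : ℤ) • triE0) (c₁ + (ky : ℤ) • triE0) :=
    ((hleft.trans (h₁.mono fun z hz => ⟨fullR_subset_Ppara hz.1, memblk.2 (Or.inr (Or.inl hz))⟩)).tail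
      (by rw [hc₁]; exact triGraph_adj_add_triDiag y₁) hright.left_mem).trans hright
  ---------------------------------------------------------------- white top–bottom crossing
  have hwP : ∀ z ∈ fullR a b ∩ ωᶜ, z ∈ Ppara a b ∩ blkᶜ := by
    rintro z ⟨hzR, hzω⟩
    refine ⟨fullR_subset_Ppara hzR, fun h => ?_⟩
    have hzR' := mem_fullR.1 hzR
    rcases memblk.1 h with h | h | h
    · omega
    · exact hzω h.2
    · omega
  set q : LatticeModels.Site 2 := t + triE1 with hq
  have hq1 : q 1 = b + 1 := by simp [hq, ht]
  have hqP : q ∈ Ppara a b ∩ blkᶜ := by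
    refine ⟨mem_Ppara_of_fullR_row hw.right_mem.1 q (by simp [hq]) (by rw [hq1]; omega)
      (by rw [hq1]), fun h => ?_⟩
    rcases memblk.1 h with h | h | h
    · omega
    · have := mem_fullR.1 h.1; omega
    · omega
  set r : LatticeModels.Site 2 := s - triE1 with hr
  have hr1 : r 1 = 0 := by simp [hr, hs]
  have hXr : brickX r = brickX s - 1 := by simp [hr, brickX]; ring
  have hrP : r ∈ Ppara a b ∩ blkᶜ := by
    refine ⟨mem_Ppara_of_fullR_row hw.left_mem.1 r (by simp [hr]) (by rw [hr1]) (by rw [hr1]; omega),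
      fun h => ?_⟩
    rcases memblk.1 h with h | h | h
    · omega
    · have := mem_fullR.1 h.1; omega
    · omega
  have hsr : s = r + triE1 := by simp [hr]
  have hwhite : PathIn LatticeModels.triGraph (Ppara a b ∩ blkᶜ) r q :=
    ((PathIn.of_adj hrP (hwP s hw.left_mem) (by rw [hsr]; exact triGraph_adj_add_triE1 r)).trans
      (hw.mono hwP)).tail (by rw [hq]; exact triGraph_adj_add_triE1 t) hqP
  ---------------------------------------------------------------- contradiction
  refine tri_hex_excl_para (pCorner b) (pWidth a b) (b + 1) blk (x := x₁ - (kx : ℤ) • triE0)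
    (y := c₁ + (ky : ℤ) • triE0) (u := r) (w := q) ?_ ?_ hblack ?_ ?_ hwhite
  · rw [sub_zsmul_triE0_apply_zero]; omega
  · rw [add_zsmul_triE0_apply_zero]; omega
  · rw [hr1, pCorner_one]
  · rw [hq1, pCorner_one, hW, zero_add]

/-- **Crossing device, mirror version**: a black path inside `R'` from the fat right edge to a
bottom-row site `y₂`, and a white vertical crossing starting at a bottom-row site `s` to the right
of `y₂`, cannot coexist. [cite: Grimmett2018, Lemma 5.20 (proof)] -/
theorem not_cross_right (hb : 1 ≤ b) {ω : SiteConfig (LatticeModels.Site 2)} {x₂ y₂ s t : LatticeModels.Site 2}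
    (hx₂ : 4 * (a : ℤ) ≤ brickX x₂) (hy₂ : y₂ 1 = 1) (h₂ : PathIn LatticeModels.triGraph (fullR a b ∩ ω) x₂ y₂)
    (hs : s 1 = 1) (ht : t 1 = b) (hw : PathIn LatticeModels.triGraph (fullR a b ∩ ωᶜ) s t)
    (hlt : brickX y₂ < brickX s) : False := by
  -- black mass: right padding, black sites of `R'`, bottom padding left of `s`
  let blk : Set (LatticeModels.Site 2) := {z | 1 ≤ z 1 ∧ z 1 ≤ b ∧ 4 * (a : ℤ) + 2 ≤ brickX z} ∪ (fullR a b ∩ ω) ∪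
    {z | z 1 = 0 ∧ brickX z + 1 ≤ brickX s}
  have memblk : ∀ {z : LatticeModels.Site 2}, z ∈ blk ↔ (1 ≤ z 1 ∧ z 1 ≤ b ∧ 4 * (a : ℤ) + 2 ≤ brickX z) ∨
      (z ∈ fullR a b ∧ z ∈ ω) ∨ (z 1 = 0 ∧ brickX z + 1 ≤ brickX s) := fun {z} => by
    simp only [blk, Set.mem_union, Set.mem_setOf_eq, Set.mem_inter_iff, or_assoc]
  have hW : (((b + 1 : ℕ) : ℤ)) = (b : ℤ) + 1 := by push_cast; ring
  have hx₂R := mem_fullR.1 h₂.left_mem.1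
  have hy₂R := mem_fullR.1 h₂.right_mem.1
  have hsR := mem_fullR.1 hw.left_mem.1
  have htR := mem_fullR.1 hw.right_mem.1
  have h₂' := h₂.symm
  ---------------------------------------------------------------- black left–right crossing
  -- along the bottom padding from the left side to the site left below `y₂`
  set c₂ : LatticeModels.Site 2 := y₂ - triE1 with hc₂
  have hc₂0 : c₂ 0 = y₂ 0 := by simp [hc₂]
  have hc₂1 : c₂ 1 = 0 := by simp [hc₂, hy₂]
  have hXc₂ : brickX c₂ = brickX y₂ - 1 := by simp [hc₂, brickX]; ring
  obtain ⟨kc, hkc⟩ : ∃ k : ℕ, (k : ℤ) = c₂ 0 - pCorner b 0 :=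
    ⟨_, Int.toNat_of_nonneg (by rw [pCorner_zero, hc₂0]; simp only [brickX] at hy₂R; omega)⟩
  have hleft : PathIn LatticeModels.triGraph (Ppara a b ∩ blk) (c₂ - (kc : ℤ) • triE0) c₂ := by
    refine triPathIn_row_left kc fun j hj => ?_
    have hj' : (j : ℤ) ≤ kc := by exact_mod_cast hj
    rw [pCorner_zero, hc₂0] at hkc
    have hy0 : 0 ≤ y₂ 0 ∧ y₂ 0 ≤ 2 * a := by simp only [brickX] at hy₂R; omega
    refine ⟨?_, memblk.2 (Or.inr (Or.inr ⟨by rw [sub_zsmul_triE0_apply_one, hc₂1], ?_⟩))⟩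
    · rw [mem_Ppara, sub_zsmul_triE0_apply_zero, sub_zsmul_triE0_apply_one, hc₂0, hc₂1]
      push_cast
      refine ⟨?_, ?_, trivial, ?_⟩
      · omega
      · omega
      · omega
    · rw [brickX_sub_zsmul_triE0, hXc₂]; omega
  -- from `x₂` along its row through the right padding to the right side
  obtain ⟨kx, hkx⟩ : ∃ k : ℕ, (k : ℤ) = pCorner b 0 + pWidth a b - x₂ 0 :=
    ⟨_, Int.toNat_of_nonneg (by
      rw [pCorner_zero, pWidth]; simp only [brickX] at hx₂R; push_cast; omega)⟩
  have hright : PathIn LatticeModels.triGraph (Ppara a b ∩ blk) x₂ (x₂ + (kx : ℤ) • triE0) := by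
    refine triPathIn_row_right kx fun j hj => ?_
    have hj' : (j : ℤ) ≤ kx := by exact_mod_cast hj
    rw [pCorner_zero, pWidth] at hkx
    push_cast at hkx
    refine ⟨?_, ?_⟩
    · rw [mem_Ppara, add_zsmul_triE0_apply_zero, add_zsmul_triE0_apply_one]
      simp only [brickX] at hx₂R
      push_cast; omega
    · rcases Nat.eq_zero_or_pos j with rfl | hjpos
      · simpa using memblk.2 (Or.inr (Or.inl ⟨h₂.left_mem.1, h₂.left_mem.2⟩))
      · refine memblk.2 (Or.inl ?_)
        rw [add_zsmul_triE0_apply_one, brickX_add_zsmul_triE0]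
        omega
  have hyc : LatticeModels.triGraph.Adj c₂ y₂ := by
    have : y₂ = c₂ + triE1 := by simp [hc₂]
    rw [this]; exact triGraph_adj_add_triE1 c₂
  have hblack : PathIn LatticeModels.triGraph (Ppara a b ∩ blk) (c₂ - (kc : ℤ) • triE0) (x₂ + (kx : ℤ) • triE0) :=
    ((hleft.tail hyc ⟨fullR_subset_Ppara h₂.right_mem.1, memblk.2 (Or.inr (Or.inl h₂.right_mem))⟩).trans
      (h₂'.mono fun z hz => ⟨fullR_subset_Ppara hz.1, memblk.2 (Or.inr (Or.inl hz))⟩)).trans hright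
  ---------------------------------------------------------------- white top–bottom crossing
  have hwP : ∀ z ∈ fullR a b ∩ ωᶜ, z ∈ Ppara a b ∩ blkᶜ := by
    rintro z ⟨hzR, hzω⟩
    refine ⟨fullR_subset_Ppara hzR, fun h => ?_⟩
    have hzR' := mem_fullR.1 hzR
    rcases memblk.1 h with h | h | h
    · omega
    · exact hzω h.2
    · omega
  set q : LatticeModels.Site 2 := t + triE1 with hq
  have hq1 : q 1 = b + 1 := by simp [hq, ht]
  have hqP : q ∈ Ppara a b ∩ blkᶜ := by
    refine ⟨mem_Ppara_of_fullR_row hw.right_mem.1 q (by simp [hq]) (by rw [hq1]; omega)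
      (by rw [hq1]), fun h => ?_⟩
    rcases memblk.1 h with h | h | h
    · omega
    · have := mem_fullR.1 h.1; omega
    · omega
  set r : LatticeModels.Site 2 := s + LatticeModels.triDiag with hr
  have hr1 : r 1 = 0 := by simp [hr, hs]
  have hXr : brickX r = brickX s + 1 := by simp [hr, brickX]; ring
  have hrP : r ∈ Ppara a b ∩ blkᶜ := by
    refine ⟨mem_Ppara_of_adj_fullR hw.left_mem.1 (by rw [hr]; exact triGraph_adj_add_triDiag s)
      (by rw [hr1]) (by rw [hr1]; omega), fun h => ?_⟩
    rcases memblk.1 h with h | h | h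
    · omega
    · have := mem_fullR.1 h.1; omega
    · omega
  have hwhite : PathIn LatticeModels.triGraph (Ppara a b ∩ blkᶜ) r q :=
    ((PathIn.of_adj hrP (hwP s hw.left_mem) (by rw [hr]; exact (triGraph_adj_add_triDiag s).symm)).trans
      (hw.mono hwP)).tail (by rw [hq]; exact triGraph_adj_add_triE1 t) hqP
  ---------------------------------------------------------------- contradiction
  refine tri_hex_excl_para (pCorner b) (pWidth a b) (b + 1) blk (x := c₂ - (kc : ℤ) • triE0)
    (y := x₂ + (kx : ℤ) • triE0) (u := r) (w := q) ?_ ?_ hblack ?_ ?_ hwhite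
  · rw [sub_zsmul_triE0_apply_zero]; omega
  · rw [add_zsmul_triE0_apply_zero]; omega
  · rw [hr1, pCorner_one]
  · rw [hq1, pCorner_one, hW, zero_add]

/-- **`A' ∩ A'' ⊆ H(R')`** (Grimmett 2018, proof of Lemma 5.20: "if `L ↔ ρJ_b` and `R ↔ J_b` then
`H_{2a,b}` occurs"): a black path from the fat left edge of `R'` to `ρJ_b` and one from the fat
right edge to `J_b` contain a horizontal crossing of `R'`. If neither path ends on the far edge,
both end on the bottom row and a white vertical crossing (which exists if `H(R')` fails,
`brick_hex`) would have to avoid both, contradicting `not_cross_left` / `not_cross_right`.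
[cite: Grimmett2018, Lemma 5.20 (proof)] -/
theorem A'ev_inter_A''ev_subset_brickHEvent (ha : 1 ≤ a) (hb : 1 ≤ b) :
    A'ev a b ∩ A''ev a b ⊆ brickHEvent 1 (4 * a + 1) 1 b := by
  rintro ω ⟨⟨x₁, y₁, hx₁, hy₁, h₁⟩, ⟨x₂, y₂, hx₂, hy₂, h₂⟩⟩
  show BrickH ω 1 (4 * a + 1) 1 b
  rcases hy₁ with hy₁ | ⟨hy₁1, hy₁X⟩
  · exact ⟨x₁, y₁, by omega, by omega, h₁⟩
  rcases hy₂ with hy₂ | ⟨hy₂1, hy₂X⟩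
  · exact ⟨y₂, x₂, by omega, by omega, h₂.symm⟩
  by_contra hH
  have hbX : (1 : ℤ) + 1 ≤ 4 * a + 1 := by omega
  rcases brick_hex ω 1 (4 * a + 1) 1 b hbX (by exact_mod_cast hb) with h | ⟨s, t, hs, ht, hw⟩
  · exact hH h
  by_cases hlt : brickX s < brickX y₁
  · exact not_cross_left hb hx₁ hy₁1 h₁ hs ht hw hlt
  · have hy : brickX y₂ < brickX s ∨ y₂ = y₁ := by
      by_cases heq : brickX y₂ = brickX y₁
      · exact Or.inr (site_eq_of_brick heq (by rw [hy₂1, hy₁1]))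
      · left; omega
    rcases hy with hy | rfl
    · exact not_cross_right hb hx₂ hy₂1 h₂ hs ht hw hy
    · exact hH ⟨x₁, x₂, by omega, by omega, h₁.trans h₂.symm⟩

/-! ### The doubling inequality -/

/-- **Smirnov's RSW doubling inequality** (Grimmett 2018, Lemma 5.20:
`P(H_{2a,b}) ≥ ¼ P(H_{a,b})²`; Werner 2009, Lemma 1.1). In brick coordinates at `p = 1/2`, for
`a, b ≥ 1`: `P(H({1 ≤ X ≤ 4a} × [1, b])) ≥ (P(H({1 ≤ X ≤ 2a} × [1, b])) / 2)²`. Proof: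
`P(H(R')) ≥ P(A' ∩ A'') ≥ P(A') P(A'') = P(A')²` by Harris–FKG and reflection symmetry, and
`P(A') ≥ P(H(R)) / 2` (`half_brickHProb_le_real_A'ev`); finally the doubled rectangle
`{1 ≤ X ≤ 4a + 1}` is harder to cross than `{1 ≤ X ≤ 4a}`. [cite: Grimmett2018, Lemma 5.20] -/
theorem rsw_doubling (ha : 1 ≤ a) (hb : 1 ≤ b) :
    (brickHProb half 1 (2 * a) 1 b / 2) ^ 2 ≤ brickHProb half 1 (4 * a) 1 b := by
  have hA := half_brickHProb_le_real_A'ev ha hb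
  have h0 : 0 ≤ brickHProb half 1 (2 * a) 1 b / 2 := by
    have := brickHProb_nonneg half 1 (2 * a) 1 b; positivity
  have hH := sitePercolation_harris half (determinedBy_A'ev (a := a) (b := b)) determinedBy_A''ev
    isUpperSet_A'ev isUpperSet_A''ev
  rw [← LatticeModels.triSitePercolation, real_A''ev] at hH
  calc (brickHProb half 1 (2 * a) 1 b / 2) ^ 2
      ≤ ((LatticeModels.triSitePercolation half).real (A'ev a b)) ^ 2 := pow_le_pow_left₀ h0 hA 2
    _ ≤ (LatticeModels.triSitePercolation half).real (A'ev a b ∩ A''ev a b) := by rw [sq]; exact hH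
    _ ≤ brickHProb half 1 (4 * a + 1) 1 b :=
        measureReal_mono (A'ev_inter_A''ev_subset_brickHEvent ha hb) (measure_ne_top _ _)
    _ ≤ brickHProb half 1 (4 * a) 1 b :=
        brickHProb_antitone half le_rfl (by omega) (by omega)

/-! ### The base case: the rhombus -/

/-- **A left–right crossing of the rhombus `R(2a, 2a)` crosses the brick rectangle
`{2a ≤ X ≤ 4a - 1} × {0 ≤ Y ≤ 2a}`** (Grimmett 2018, proof of Lemma 5.22: "on `B`, there exists a
left–right crossing of the (sub-)rectangle `[a, 2a] × [0, a√3]`"). [cite: Grimmett2018, Lemma 5.22] -/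
theorem triLRCrossing_subset_brickHEvent (ha : 1 ≤ a) :
    Literature.Probability.Percolation.triLRCrossing (2 * a) (2 * a) ⊆ brickHEvent (2 * a) (4 * a - 1) 0 (2 * a) := by
  intro ω hω
  obtain ⟨x, hx, y, hy, hxy⟩ := Literature.Probability.Percolation.mem_triLRCrossing_iff.1 hω
  have hx' := Finset.mem_filter.1 hx
  have hy' := Finset.mem_filter.1 hy
  have hxR := mem_rectangle_iff.1 hx'.1
  have hyR := mem_rectangle_iff.1 hy'.1
  refine brickH_of_pathIn (PathIn.of_mem_siteConnIn hxy) ?_ ?_ (by omega) fun z hz h1 h2 => ?_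
  · simp only [brickX]; rw [hx'.2]; omega
  · simp only [brickX]; rw [hy'.2]; push_cast; omega
  · rw [Finset.mem_coe, mem_rectangle_iff] at hz
    rw [mem_brickRect]
    exact ⟨h1, h2, hz.2.2.1, hz.2.2.2⟩

/-- **Base case `h(a, 2a + 1) ≥ 1/2`** (Grimmett 2018, Lemma 5.22: `P(H_{a, a√3}) ≥ 1/2`): the
rhombus `R(2a, 2a)` is crossed with probability `1/2` (`triLRCrossingProb_half_self`), such a
crossing crosses `{2a ≤ X ≤ 4a - 1} × [0, 2a]`, and this is a translate of
`{1 ≤ X ≤ 2a} × [1, 2a + 1]`. [cite: Grimmett2018, Lemma 5.22] -/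
theorem half_le_brickHProb_base (ha : 1 ≤ a) :
    1 / 2 ≤ brickHProb half 1 (2 * a) 1 (2 * a + 1) := by
  have h1 : Literature.Probability.Percolation.triLRCrossingProb half (2 * a) (2 * a) ≤
      brickHProb half (2 * a) (4 * a - 1) 0 (2 * a) :=
    measureReal_mono (triLRCrossing_subset_brickHEvent ha) (measure_ne_top _ _)
  rw [triLRCrossingProb_half_self] at h1
  have h2 := brickHProb_shift half ![(a : ℤ), -1] 1 (2 * a) 1 (2 * a + 1)
  have hX : brickX ![(a : ℤ), -1] = 2 * a - 1 := by simp [brickX]; ring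
  have hY : (![(a : ℤ), -1] : LatticeModels.Site 2) 1 = -1 := rfl
  rw [hX, hY] at h2
  have e1 : (1 : ℤ) + (2 * a - 1) = 2 * a := by ring
  have e2 : (2 * (a : ℤ)) + (2 * a - 1) = 4 * a - 1 := by ring
  have e3 : (1 : ℤ) + -1 = 0 := by ring
  have e4 : (2 * (a : ℤ) + 1) + -1 = 2 * a := by ring
  rw [e1, e2, e3, e4] at h2
  rw [← h2]; exact h1

/-! ### Iteration -/

/-- **RSW for long rectangles** (Grimmett 2018, (5.21) with Lemma 5.22:
`P(H_{2^k a, b}) ≥ 4 [¼ P(H_{a,b})]^{2^k}` and `P(H_{a, a√3}) ≥ ½`; Werner 2009, Cor. 1.1). At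
`p = 1/2`, for all `k` and `a ≥ 1`, the brick rectangle `{1 ≤ X ≤ 2^{k+1} a} × {1 ≤ Y ≤ 2a + 1}`
(Euclidean aspect ratio `2^k / √3`) has a black horizontal crossing with probability at least
`4 · 8^{-2^k}`. [cite: Grimmett2018, Theorem 5.23 (proof, eq. (5.21))] -/
theorem rsw_iterate (k : ℕ) (ha : 1 ≤ a) :
    4 * (1 / 8 : ℝ) ^ (2 ^ k) ≤ brickHProb half 1 (2 * (2 ^ k * a)) 1 (2 * a + 1) := by
  induction k with
  | zero =>
    have := half_le_brickHProb_base ha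
    norm_num at this ⊢
    simpa using this
  | succ k ih =>
    have hak : 1 ≤ 2 ^ k * a := Nat.one_le_iff_ne_zero.2 (by positivity)
    have hd := rsw_doubling (a := 2 ^ k * a) (b := 2 * a + 1) hak (by omega)
    push_cast at hd ih ⊢
    have h4 : (4 : ℤ) * (2 ^ k * (a : ℤ)) = 2 * (2 ^ (k + 1) * a) := by ring
    rw [h4] at hd
    refine le_trans ?_ hd
    have h0 : 0 ≤ 4 * (1 / 8 : ℝ) ^ (2 ^ k) := by positivity
    calc 4 * (1 / 8 : ℝ) ^ 2 ^ (k + 1) = (4 * (1 / 8 : ℝ) ^ (2 ^ k) / 2) ^ 2 := by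
          rw [pow_succ, pow_mul]; ring
      _ ≤ (brickHProb half 1 (2 * (2 ^ k * a)) 1 (2 * a + 1) / 2) ^ 2 := by
          gcongr

end SmirnovRSW

/-! ### Central inversion and transposition

Both are automorphisms of `𝕋`: `triGraph_adj_neg` (`TriRSWChaining.lean`),
`triGraph_adj_transposeIso` (`TriHexLemma.lean`). -/

/-- The brick coordinate is odd: `X(-x) = -X(x)`. [folklore] -/
@[simp] theorem brickX_neg (x : LatticeModels.Site 2) : brickX (-x) = -brickX x := by
  simp only [brickX, Pi.neg_apply]; ring

/-- The transposition composed with the central inversion, `x ↦ (-x)ᵗ`, preserves adjacency.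
[folklore] -/
theorem triGraph_adj_transpose_neg {x y : LatticeModels.Site 2} (h : LatticeModels.triGraph.Adj x y) :
    LatticeModels.triGraph.Adj (((Equiv.neg (LatticeModels.Site 2)).trans transposeIso.toEquiv) x)
      (((Equiv.neg (LatticeModels.Site 2)).trans transposeIso.toEquiv) y) := by
  simp only [Equiv.trans_apply, Equiv.neg_apply, RelIso.coe_fn_toEquiv]
  exact triGraph_adj_transposeIso (triGraph_adj_neg h)

/-! ### Short-way crossings of a strip -/

/-- **A path climbing through a strip crosses it vertically.** If a `𝕋`-path inside `S ⊆ ω`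
starts strictly below row `Y₀` and ends on row `Y₁ ≥ Y₀`, and every site of `S` has brick
coordinate in `[X₀, X₁]` and row `≤ Y₁`, then `ω` contains a vertical crossing of the brick
rectangle `[X₀, X₁] × [Y₀, Y₁]` (the segment after the last visit below row `Y₀`).
(Werner 2009, proof of Cor. 1.2: "if `∂Λ_{2^j} ⟷ ∂Λ_{2^{j+l}}` then none of the events `C_j`
holds".) [cite: Werner2009, Corollary 1.2 (proof)] -/
theorem brickV_of_pathIn {S ω : Set (LatticeModels.Site 2)} {X₀ X₁ Y₀ Y₁ : ℤ} {x g : LatticeModels.Site 2}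
    (h : PathIn LatticeModels.triGraph S x g) (hSω : S ⊆ ω) (hx : x 1 < Y₀) (hg : g 1 = Y₁) (hY : Y₀ ≤ Y₁)
    (hS : ∀ z ∈ S, X₀ ≤ brickX z ∧ brickX z ≤ X₁ ∧ z 1 ≤ Y₁) : BrickV ω X₀ X₁ Y₀ Y₁ := by
  obtain ⟨c, d, hcC, -, hdC, hcd, hdg⟩ := h.last_exit (C := {z : LatticeModels.Site 2 | z 1 < Y₀}) hx
    (by simp only [Set.mem_setOf_eq, hg, not_lt]; exact hY)
  simp only [Set.mem_setOf_eq, not_lt] at hcC hdC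
  have hd : d 1 = Y₀ := by have := (row_adj_le hcd).1; omega
  refine ⟨d, g, hd, hg, hdg.mono ?_⟩
  rintro z ⟨hzS, hzC⟩
  simp only [Set.mem_setOf_eq, not_lt] at hzC
  obtain ⟨h1, h2, h3⟩ := hS z hzS
  exact ⟨⟨h1, h2, hzC, h3⟩, hSω hzS⟩

/-- Coordinates of the sites of the box `Λ(n) = [-n, n]²`. [folklore] -/
theorem coord_of_mem_box {n : ℕ} {y : LatticeModels.Site 2} (hy : y ∈ (↑(LatticeModels.box 2 n) : Set (LatticeModels.Site 2))) :
    -(n : ℤ) ≤ y 0 ∧ y 0 ≤ n ∧ -(n : ℤ) ≤ y 1 ∧ y 1 ≤ n := by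
  rw [Finset.mem_coe, LatticeModels.mem_box] at hy
  exact ⟨(hy 0).1, (hy 0).2, (hy 1).1, (hy 1).2⟩

/-- **Blocking lemma** (Werner 2009, Lemma 1.2 / Cor. 1.2: closed crossings of well-chosen
rotated rectangles form a closed circuit in the annulus, which no open path from the inside to
the outside can cross). Let `S_a = {|X| ≤ 9a + 3} × {a + 1 ≤ Y ≤ 3a + 1}` (brick coordinates).
If `S_a` has a white horizontal crossing in each of the configurations `ω`, `-ω`, `ωᵗ` and
`(-ω)ᵗ`, then no black `𝕋`-path joins the origin to a site outside the box `Λ(3a + 1)`: at its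
first exit from the box the path has climbed (in `ω`, `-ω`, `ωᵗ` or `(-ω)ᵗ` according to the
side) from row `≤ a` to row `3a + 1` inside the box, whose sites have `|X| ≤ 9a + 3`, giving a
black vertical crossing of `S_a` in that configuration (`brickV_of_pathIn`), which the Hex lemma
`brick_hex_excl'` forbids. [cite: Werner2009, Lemma 1.2 and Corollary 1.2] -/
theorem not_pathIn_of_annulus {a : ℕ} {ω : SiteConfig (LatticeModels.Site 2)} {z : LatticeModels.Site 2}
    (hT : BrickH ωᶜ (-(9 * a + 3)) (9 * a + 3) (a + 1) (3 * a + 1))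
    (hB : BrickH (Equiv.neg (LatticeModels.Site 2) '' ωᶜ) (-(9 * a + 3)) (9 * a + 3) (a + 1) (3 * a + 1))
    (hR : BrickH (transposeIso.toEquiv '' ωᶜ) (-(9 * a + 3)) (9 * a + 3) (a + 1) (3 * a + 1))
    (hL : BrickH (((Equiv.neg (LatticeModels.Site 2)).trans transposeIso.toEquiv) '' ωᶜ)
      (-(9 * a + 3)) (9 * a + 3) (a + 1) (3 * a + 1))
    (hp : PathIn LatticeModels.triGraph ω 0 z) (hz : z ∉ (↑(LatticeModels.box 2 (3 * a + 1)) : Set (LatticeModels.Site 2))) : False := by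
  have h0 : (0 : LatticeModels.Site 2) ∈ (↑(LatticeModels.box 2 (3 * a + 1)) : Set (LatticeModels.Site 2)) := by
    rw [Finset.mem_coe, LatticeModels.mem_box]; intro i; simp only [Pi.zero_apply]; omega
  obtain ⟨g, g', hg, hg', -, hgg', hpg⟩ := hp.exit h0 hz
  obtain ⟨hg0, hg0', hg1, hg1'⟩ := coord_of_mem_box hg
  rw [Finset.mem_coe, LatticeModels.mem_box, not_forall] at hg'
  obtain ⟨i, hi⟩ := hg'
  have hc0 := triGraph_adj_coord hgg' 0
  have hc1 := triGraph_adj_coord hgg' 1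
  have hsub : (↑(LatticeModels.box 2 (3 * a + 1)) : Set (LatticeModels.Site 2)) ∩ ω ⊆ ω := Set.inter_subset_right
  have hx0 : (0 : LatticeModels.Site 2) 1 < (a : ℤ) + 1 := by simp only [Pi.zero_apply]; omega
  fin_cases i
  · -- exit through a vertical side: `g 0 = ± (3a + 1)`
    rcases not_and_or.1 hi with hi | hi
    · -- left side: transport by `x ↦ (-x)ᵗ`
      have hg0e : g 0 = -(3 * (a : ℤ) + 1) := by push_cast at hi hg0; omega
      set f : LatticeModels.Site 2 ≃ LatticeModels.Site 2 := (Equiv.neg (LatticeModels.Site 2)).trans transposeIso.toEquiv with hf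
      have hpath := hpg.map_adj f (fun _ _ h => triGraph_adj_transpose_neg h)
      have hf0 : f 0 = 0 := by
        ext j; fin_cases j <;> simp [hf]
      rw [hf0] at hpath
      have hfg : (f g) 1 = 3 * a + 1 := by
        simp [hf, hg0e]
      have hV := brickV_of_pathIn (X₀ := -(9 * a + 3)) (X₁ := 9 * a + 3) hpath (Set.image_mono hsub)
        hx0 hfg (by omega) ?_
      · rw [Set.image_compl_eq f.bijective] at hL
        exact brick_hex_excl' _ _ _ _ _ hL hV
      · rintro _ ⟨y, ⟨hy, -⟩, rfl⟩
        obtain ⟨h1, h2, h3, h4⟩ := coord_of_mem_box hy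
        simp only [hf, Equiv.trans_apply, Equiv.neg_apply, RelIso.coe_fn_toEquiv, brickX,
          transposeIso_apply_zero, transposeIso_apply_one, Pi.neg_apply]
        push_cast at h1 h2 h3 h4 ⊢
        omega
    · -- right side: transport by the transposition
      have hg0e : g 0 = 3 * (a : ℤ) + 1 := by push_cast at hi hg0'; omega
      set f : LatticeModels.Site 2 ≃ LatticeModels.Site 2 := transposeIso.toEquiv with hf
      have hpath := hpg.map_adj f (fun _ _ h => by
        simpa only [hf, RelIso.coe_fn_toEquiv] using triGraph_adj_transposeIso h)
      have hf0 : f 0 = 0 := by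
        ext j; fin_cases j <;> simp [hf]
      rw [hf0] at hpath
      have hfg : (f g) 1 = 3 * a + 1 := by
        simp [hf, hg0e]
      have hV := brickV_of_pathIn (X₀ := -(9 * a + 3)) (X₁ := 9 * a + 3) hpath (Set.image_mono hsub)
        hx0 hfg (by omega) ?_
      · rw [Set.image_compl_eq f.bijective] at hR
        exact brick_hex_excl' _ _ _ _ _ hR hV
      · rintro _ ⟨y, ⟨hy, -⟩, rfl⟩
        obtain ⟨h1, h2, h3, h4⟩ := coord_of_mem_box hy
        simp only [hf, RelIso.coe_fn_toEquiv, brickX, transposeIso_apply_zero,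
          transposeIso_apply_one]
        push_cast at h1 h2 h3 h4 ⊢
        omega
  · -- exit through a horizontal side: `g 1 = ± (3a + 1)`
    rcases not_and_or.1 hi with hi | hi
    · -- bottom side: transport by the central inversion
      have hg1e : g 1 = -(3 * (a : ℤ) + 1) := by push_cast at hi hg1; omega
      set f : LatticeModels.Site 2 ≃ LatticeModels.Site 2 := Equiv.neg (LatticeModels.Site 2) with hf
      have hpath := hpg.map_adj f (fun _ _ h => by
        simpa only [hf, Equiv.neg_apply] using triGraph_adj_neg h)
      have hf0 : f 0 = 0 := by simp [hf]
      rw [hf0] at hpath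
      have hfg : (f g) 1 = 3 * a + 1 := by
        simp [hf, hg1e]
      have hV := brickV_of_pathIn (X₀ := -(9 * a + 3)) (X₁ := 9 * a + 3) hpath (Set.image_mono hsub)
        hx0 hfg (by omega) ?_
      · rw [Set.image_compl_eq f.bijective] at hB
        exact brick_hex_excl' _ _ _ _ _ hB hV
      · rintro _ ⟨y, ⟨hy, -⟩, rfl⟩
        obtain ⟨h1, h2, h3, h4⟩ := coord_of_mem_box hy
        simp only [hf, Equiv.neg_apply, brickX, Pi.neg_apply]
        push_cast at h1 h2 h3 h4 ⊢
        omega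
    · -- top side: no transport needed
      have hg1e : g 1 = 3 * (a : ℤ) + 1 := by push_cast at hi hg1'; omega
      have hV := brickV_of_pathIn (X₀ := -(9 * a + 3)) (X₁ := 9 * a + 3) hpg hsub hx0 hg1e
        (by omega) ?_
      · exact brick_hex_excl' _ _ _ _ _ hT hV
      · rintro y ⟨hy, -⟩
        obtain ⟨h1, h2, h3, h4⟩ := coord_of_mem_box hy
        simp only [brickX]
        push_cast at h1 h2 h3 h4 ⊢
        omega

/-! ### Independence of events with pairwise disjoint finite supports -/

/-- **Events determined by pairwise disjoint finite sets of sites are independent**: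
`P_p(⋂_{j<k} A_jᶜ) = ∏_{j<k} (1 - P_p(A_j))` (Werner 2009, proof of Cor. 1.2: "because of the
independence of the realization of percolation in each of the disjoint annuli"; by induction
from `sitePercolation_real_inter_of_disjoint`). [cite: Werner2009, Corollary 1.2 (proof)] -/
theorem real_biInter_compl_eq_prod {V : Type*} (p : unitInterval) {A : ℕ → Set (SiteConfig V)}
    {K : ℕ → Finset V} (hA : ∀ j, DeterminedBy (A j) ↑(K j))
    (hK : ∀ i j, i < j → Disjoint (K i) (K j)) (k : ℕ) :
    (sitePercolation V p).real (⋂ j ∈ Finset.range k, (A j)ᶜ) =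
      ∏ j ∈ Finset.range k, (1 - (sitePercolation V p).real (A j)) := by
  classical
  induction k with
  | zero => simp
  | succ k ih =>
    rw [Finset.range_add_one, Finset.set_biInter_insert, Finset.prod_insert
      Finset.notMem_range_self, ← ih,
      ← probReal_compl_eq_one_sub (hA k).measurableSet_of_finset]
    refine sitePercolation_real_inter_of_disjoint p (hA k).compl
      (F := K k) (G := (Finset.range k).biUnion K) ?_ ?_
    · exact DeterminedBy.iInter fun j => DeterminedBy.iInter fun hj =>
        ((hA j).compl).mono (Finset.coe_subset.2
          (Finset.subset_biUnion_of_mem K hj))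
    · rw [Finset.disjoint_biUnion_right]
      intro j hj
      exact (hK j k (Finset.mem_range.1 hj)).symm

/-! ### The four-strip event and its probability -/

/-- The strip `S_a` lies in the annulus `Λ(6a + 2) ∖ Λ(a)`, and so do its images under the
central inversion and the transposition: if `e` permutes and/or negates the two coordinates, a
site `z` with `e z ∈ S_a` lies in the annulus. [folklore] -/
theorem preimage_strip_subset_annulus (a : ℕ) (e : LatticeModels.Site 2 ≃ LatticeModels.Site 2)
    (he : ∀ z, ((e z) 0 = z 0 ∨ (e z) 0 = -z 0) ∧ ((e z) 1 = z 1 ∨ (e z) 1 = -z 1) ∨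
      ((e z) 0 = z 1 ∨ (e z) 0 = -z 1) ∧ ((e z) 1 = z 0 ∨ (e z) 1 = -z 0)) :
    e ⁻¹' brickRect (-(9 * a + 3)) (9 * a + 3) (a + 1) (3 * a + 1) ⊆
      (↑(LatticeModels.box 2 (6 * a + 2) \ LatticeModels.box 2 a) : Set (LatticeModels.Site 2)) := by
  intro z hz
  rw [Set.mem_preimage, mem_brickRect] at hz
  simp only [brickX] at hz
  rw [Finset.coe_sdiff, Set.mem_sdiff, Finset.mem_coe, Finset.mem_coe, LatticeModels.mem_box, LatticeModels.mem_box,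
    Fin.forall_fin_two, Fin.forall_fin_two]
  push_cast
  rcases he z with ⟨h0 | h0, h1 | h1⟩ | ⟨h0 | h0, h1 | h1⟩ <;> omega

/-- The black horizontal crossing of `S_a` seen through such a symmetry `e` is an event
determined by the annulus `Λ(6a + 2) ∖ Λ(a)`. [cite: Werner2009, Lemma 1.2] -/
theorem determinedBy_relabel_strip (a : ℕ) (e : LatticeModels.Site 2 ≃ LatticeModels.Site 2)
    (he : ∀ z, ((e z) 0 = z 0 ∨ (e z) 0 = -z 0) ∧ ((e z) 1 = z 1 ∨ (e z) 1 = -z 1) ∨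
      ((e z) 0 = z 1 ∨ (e z) 0 = -z 1) ∧ ((e z) 1 = z 0 ∨ (e z) 1 = -z 0)) :
    DeterminedBy (SiteConfig.relabel e ⁻¹' brickHEvent (-(9 * a + 3)) (9 * a + 3) (a + 1) (3 * a + 1))
      ↑(LatticeModels.box 2 (6 * a + 2) \ LatticeModels.box 2 a) := by
  have hD := determinedBy_brickHEvent (-(9 * a + 3)) (9 * a + 3) (a + 1) (3 * a + 1)
  rw [coe_brickFinset] at hD
  refine (determinedBy_preimage_relabel e hD).mono ?_
  rw [Equiv.image_eq_preimage_symm, Equiv.symm_symm]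
  exact preimage_strip_subset_annulus a e he

/-- The black horizontal crossing of `S_a` is determined by the annulus `Λ(6a + 2) ∖ Λ(a)`.
[cite: Werner2009, Lemma 1.2] -/
theorem determinedBy_strip (a : ℕ) :
    DeterminedBy (brickHEvent (-(9 * a + 3)) (9 * a + 3) (a + 1) (3 * a + 1))
      ↑(LatticeModels.box 2 (6 * a + 2) \ LatticeModels.box 2 a) := by
  have hD := determinedBy_brickHEvent (-(9 * a + 3)) (9 * a + 3) (a + 1) (3 * a + 1)
  rw [coe_brickFinset] at hD
  have h := preimage_strip_subset_annulus a (Equiv.refl _) fun z => Or.inl ⟨Or.inl rfl, Or.inl rfl⟩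
  exact hD.mono (by simpa using h)

/-- The central inversion negates both coordinates. [folklore] -/
theorem neg_equiv_coord (z : LatticeModels.Site 2) :
    ((Equiv.neg (LatticeModels.Site 2) z) 0 = z 0 ∨ (Equiv.neg (LatticeModels.Site 2) z) 0 = -z 0) ∧
        ((Equiv.neg (LatticeModels.Site 2) z) 1 = z 1 ∨ (Equiv.neg (LatticeModels.Site 2) z) 1 = -z 1) ∨
      ((Equiv.neg (LatticeModels.Site 2) z) 0 = z 1 ∨ (Equiv.neg (LatticeModels.Site 2) z) 0 = -z 1) ∧
        ((Equiv.neg (LatticeModels.Site 2) z) 1 = z 0 ∨ (Equiv.neg (LatticeModels.Site 2) z) 1 = -z 0) :=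
  Or.inl ⟨Or.inr (by simp), Or.inr (by simp)⟩

/-- The transposition exchanges the coordinates. [folklore] -/
theorem transpose_equiv_coord (z : LatticeModels.Site 2) :
    ((transposeIso.toEquiv z) 0 = z 0 ∨ (transposeIso.toEquiv z) 0 = -z 0) ∧
        ((transposeIso.toEquiv z) 1 = z 1 ∨ (transposeIso.toEquiv z) 1 = -z 1) ∨
      ((transposeIso.toEquiv z) 0 = z 1 ∨ (transposeIso.toEquiv z) 0 = -z 1) ∧
        ((transposeIso.toEquiv z) 1 = z 0 ∨ (transposeIso.toEquiv z) 1 = -z 0) :=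
  Or.inr ⟨Or.inl (by simp), Or.inl (by simp)⟩

/-- `x ↦ (-x)ᵗ` exchanges and negates the coordinates. [folklore] -/
theorem transpose_neg_equiv_coord (z : LatticeModels.Site 2) :
    ((((Equiv.neg (LatticeModels.Site 2)).trans transposeIso.toEquiv) z) 0 = z 0 ∨
          (((Equiv.neg (LatticeModels.Site 2)).trans transposeIso.toEquiv) z) 0 = -z 0) ∧
        ((((Equiv.neg (LatticeModels.Site 2)).trans transposeIso.toEquiv) z) 1 = z 1 ∨
          (((Equiv.neg (LatticeModels.Site 2)).trans transposeIso.toEquiv) z) 1 = -z 1) ∨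
      ((((Equiv.neg (LatticeModels.Site 2)).trans transposeIso.toEquiv) z) 0 = z 1 ∨
          (((Equiv.neg (LatticeModels.Site 2)).trans transposeIso.toEquiv) z) 0 = -z 1) ∧
        ((((Equiv.neg (LatticeModels.Site 2)).trans transposeIso.toEquiv) z) 1 = z 0 ∨
          (((Equiv.neg (LatticeModels.Site 2)).trans transposeIso.toEquiv) z) 1 = -z 0) :=
  Or.inr ⟨Or.inr (by simp), Or.inr (by simp)⟩

/-- The black four-strip event at scale `a` — black horizontal crossings of `S_a` in `ω`, `-ω`,
`ωᵗ` and `(-ω)ᵗ` — is determined by the sites of the annulus `Λ(6a + 2) ∖ Λ(a)`.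
[cite: Werner2009, Lemma 1.2] -/
theorem determinedBy_annulusEvent (a : ℕ) :
    DeterminedBy
      (brickHEvent (-(9 * a + 3)) (9 * a + 3) (a + 1) (3 * a + 1) ∩
        SiteConfig.relabel (Equiv.neg (LatticeModels.Site 2)) ⁻¹'
          brickHEvent (-(9 * a + 3)) (9 * a + 3) (a + 1) (3 * a + 1) ∩
        SiteConfig.relabel transposeIso.toEquiv ⁻¹'
          brickHEvent (-(9 * a + 3)) (9 * a + 3) (a + 1) (3 * a + 1) ∩
        SiteConfig.relabel ((Equiv.neg (LatticeModels.Site 2)).trans transposeIso.toEquiv) ⁻¹'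
          brickHEvent (-(9 * a + 3)) (9 * a + 3) (a + 1) (3 * a + 1))
      ↑(LatticeModels.box 2 (6 * a + 2) \ LatticeModels.box 2 a) :=
  (((determinedBy_strip a).inter (determinedBy_relabel_strip a _ neg_equiv_coord)).inter
    (determinedBy_relabel_strip a _ transpose_equiv_coord)).inter
    (determinedBy_relabel_strip a _ transpose_neg_equiv_coord)

/-- The black four-strip event is increasing. [cite: Werner2009, Lemma 1.2] -/
theorem isUpperSet_annulusEvent (a : ℕ) :
    IsUpperSet
      (brickHEvent (-(9 * a + 3)) (9 * a + 3) (a + 1) (3 * a + 1) ∩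
        SiteConfig.relabel (Equiv.neg (LatticeModels.Site 2)) ⁻¹'
          brickHEvent (-(9 * a + 3)) (9 * a + 3) (a + 1) (3 * a + 1) ∩
        SiteConfig.relabel transposeIso.toEquiv ⁻¹'
          brickHEvent (-(9 * a + 3)) (9 * a + 3) (a + 1) (3 * a + 1) ∩
        SiteConfig.relabel ((Equiv.neg (LatticeModels.Site 2)).trans transposeIso.toEquiv) ⁻¹'
          brickHEvent (-(9 * a + 3)) (9 * a + 3) (a + 1) (3 * a + 1)) :=
  have hU := isUpperSet_brickHEvent (-(9 * a + 3)) (9 * a + 3) (a + 1) (3 * a + 1)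
  ((hU.inter (isUpperSet_preimage_relabel _ hU)).inter (isUpperSet_preimage_relabel _ hU)).inter
    (isUpperSet_preimage_relabel _ hU)

/-- **RSW input: the strip `S_a` is crossed the long way with probability `≥ c = 4 · 8⁻¹⁶` at
`p = 1/2`** for `a ≥ 1`: the `32a × (2a + 1)` brick rectangle of `rsw_iterate` (`k = 4`),
translated by `(-(5a + 2), a)` and narrowed to `{|X| ≤ 9a + 3}` (`brickHProb_shift`,
`brickHProb_antitone`). [cite: Grimmett2018, Theorem 5.23 (proof, eq. (5.21))] -/
theorem le_brickHProb_strip {a : ℕ} (ha : 1 ≤ a) :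
    4 * (1 / 8 : ℝ) ^ 16 ≤ brickHProb half (-(9 * a + 3)) (9 * a + 3) (a + 1) (3 * a + 1) := by
  have h1 := SmirnovRSW.rsw_iterate (a := a) 4 ha
  have h2 := brickHProb_shift half ![-(5 * (a : ℤ) + 2), a] 1 (2 * (2 ^ 4 * a)) 1 (2 * a + 1)
  have hX : brickX ![-(5 * (a : ℤ) + 2), a] = -(9 * a + 4) := by simp [brickX]; ring
  have hY : (![-(5 * (a : ℤ) + 2), a] : LatticeModels.Site 2) 1 = a := rfl
  rw [hX, hY] at h2
  push_cast at h1 h2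
  have e1 : (1 : ℤ) + a = a + 1 := by ring
  have e2 : (2 : ℤ) * a + 1 + a = 3 * a + 1 := by ring
  rw [e1, e2] at h2
  calc 4 * (1 / 8 : ℝ) ^ 16 ≤ _ := h1
    _ = _ := h2.symm
    _ ≤ _ := brickHProb_antitone half (by omega) (by omega) (by omega)

/-- **`P_{1/2}` of the black four-strip event is at least `c⁴`**, `c = 4 · 8⁻¹⁶`, for `a ≥ 1`
(Werner 2009, Lemma 1.2: `P(C_j) ≥ a_4^6` by Harris' inequality and RSW; here four strips and
Harris thrice, each strip event having probability `P_{1/2}(H(S_a)) ≥ c` by the invariance of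
`P_{1/2}` under the central inversion and the transposition). [cite: Werner2009, Lemma 1.2] -/
theorem le_real_annulusEvent {a : ℕ} (ha : 1 ≤ a) :
    (4 * (1 / 8 : ℝ) ^ 16) ^ 4 ≤
      (sitePercolation (LatticeModels.Site 2) half).real
        (brickHEvent (-(9 * a + 3)) (9 * a + 3) (a + 1) (3 * a + 1) ∩
          SiteConfig.relabel (Equiv.neg (LatticeModels.Site 2)) ⁻¹'
            brickHEvent (-(9 * a + 3)) (9 * a + 3) (a + 1) (3 * a + 1) ∩
          SiteConfig.relabel transposeIso.toEquiv ⁻¹'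
            brickHEvent (-(9 * a + 3)) (9 * a + 3) (a + 1) (3 * a + 1) ∩
          SiteConfig.relabel ((Equiv.neg (LatticeModels.Site 2)).trans transposeIso.toEquiv) ⁻¹'
            brickHEvent (-(9 * a + 3)) (9 * a + 3) (a + 1) (3 * a + 1)) := by
  set E := brickHEvent (-(9 * a + 3)) (9 * a + 3) (a + 1) (3 * a + 1) with hE
  set c : ℝ := 4 * (1 / 8 : ℝ) ^ 16 with hc
  have hc0 : 0 ≤ c := by rw [hc]; positivity
  -- each of the four events has probability `P(E) ≥ c`
  have hPE : c ≤ (sitePercolation (LatticeModels.Site 2) half).real E := le_brickHProb_strip ha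
  have hPe : ∀ e : LatticeModels.Site 2 ≃ LatticeModels.Site 2,
      c ≤ (sitePercolation (LatticeModels.Site 2) half).real (SiteConfig.relabel e ⁻¹' E) := fun e => by
    rw [sitePercolation_real_preimage_relabel]; exact hPE
  -- supports and monotonicity
  have hD1 := determinedBy_strip a
  have hD2 := determinedBy_relabel_strip a _ neg_equiv_coord
  have hD3 := determinedBy_relabel_strip a _ transpose_equiv_coord
  have hD4 := determinedBy_relabel_strip a _ transpose_neg_equiv_coord
  have hU1 := isUpperSet_brickHEvent (-(9 * a + 3)) (9 * a + 3) (a + 1) (3 * a + 1)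
  have hU2 := isUpperSet_preimage_relabel (Equiv.neg (LatticeModels.Site 2)) hU1
  have hU3 := isUpperSet_preimage_relabel transposeIso.toEquiv hU1
  have hU4 := isUpperSet_preimage_relabel ((Equiv.neg (LatticeModels.Site 2)).trans transposeIso.toEquiv) hU1
  -- Harris thrice
  have h12 := sitePercolation_harris half hD1 hD2 hU1 hU2
  have h123 := sitePercolation_harris half (hD1.inter hD2) hD3 (hU1.inter hU2) hU3
  have h1234 := sitePercolation_harris half ((hD1.inter hD2).inter hD3) hD4
    ((hU1.inter hU2).inter hU3) hU4
  have n1 : 0 ≤ (sitePercolation (LatticeModels.Site 2) half).real E := measureReal_nonneg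
  have n2 : 0 ≤ (sitePercolation (LatticeModels.Site 2) half).real
      (SiteConfig.relabel (Equiv.neg (LatticeModels.Site 2)) ⁻¹' E) := measureReal_nonneg
  have n3 : 0 ≤ (sitePercolation (LatticeModels.Site 2) half).real
      (SiteConfig.relabel transposeIso.toEquiv ⁻¹' E) := measureReal_nonneg
  have n4 : 0 ≤ (sitePercolation (LatticeModels.Site 2) half).real
      (SiteConfig.relabel ((Equiv.neg (LatticeModels.Site 2)).trans transposeIso.toEquiv) ⁻¹' E) :=
    measureReal_nonneg
  calc c ^ 4 = c * c * c * c := by ring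
    _ ≤ (sitePercolation (LatticeModels.Site 2) half).real E *
          (sitePercolation (LatticeModels.Site 2) half).real (SiteConfig.relabel (Equiv.neg (LatticeModels.Site 2)) ⁻¹' E) *
          (sitePercolation (LatticeModels.Site 2) half).real (SiteConfig.relabel transposeIso.toEquiv ⁻¹' E) *
          (sitePercolation (LatticeModels.Site 2) half).real
            (SiteConfig.relabel ((Equiv.neg (LatticeModels.Site 2)).trans transposeIso.toEquiv) ⁻¹' E) :=
        mul_le_mul (mul_le_mul (mul_le_mul hPE (hPe _) hc0 n1) (hPe _) hc0 (mul_nonneg n1 n2))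
          (hPe _) hc0 (mul_nonneg (mul_nonneg n1 n2) n3)
    _ ≤ _ := by
        refine le_trans (mul_le_mul_of_nonneg_right (mul_le_mul_of_nonneg_right h12 n3) n4) ?_
        exact le_trans (mul_le_mul_of_nonneg_right h123 n4) h1234

/-! ### No exit at `p = 1/2`: `θ(1/2) ≤ (1 - c⁴)^k` -/

/-- **The exit event is blocked by the white four-strip events** (Werner 2009, Cor. 1.2): if the
origin is joined inside `Λ(8^k)` to its inner boundary by a black path, then for no `j < k` does
the complement configuration `ωᶜ` lie in the black four-strip event at scale `8^j` (the endpoint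
lies outside `Λ(3 · 8^j + 1)`, and `not_pathIn_of_annulus` applies). [cite: Werner2009, Corollary 1.2] -/
theorem exitEvent_subset_compl_preimage (k : ℕ) :
    exitEvent LatticeModels.triGraph (LatticeModels.box 2 (8 ^ k)) 0 ⊆
      compl ⁻¹' ⋂ j ∈ Finset.range k,
        (brickHEvent (-(9 * (8 ^ j : ℕ) + 3)) (9 * (8 ^ j : ℕ) + 3) ((8 ^ j : ℕ) + 1)
              (3 * (8 ^ j : ℕ) + 1) ∩
          SiteConfig.relabel (Equiv.neg (LatticeModels.Site 2)) ⁻¹'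
            brickHEvent (-(9 * (8 ^ j : ℕ) + 3)) (9 * (8 ^ j : ℕ) + 3) ((8 ^ j : ℕ) + 1)
              (3 * (8 ^ j : ℕ) + 1) ∩
          SiteConfig.relabel transposeIso.toEquiv ⁻¹'
            brickHEvent (-(9 * (8 ^ j : ℕ) + 3)) (9 * (8 ^ j : ℕ) + 3) ((8 ^ j : ℕ) + 1)
              (3 * (8 ^ j : ℕ) + 1) ∩
          SiteConfig.relabel ((Equiv.neg (LatticeModels.Site 2)).trans transposeIso.toEquiv) ⁻¹'
            brickHEvent (-(9 * (8 ^ j : ℕ) + 3)) (9 * (8 ^ j : ℕ) + 3) ((8 ^ j : ℕ) + 1)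
              (3 * (8 ^ j : ℕ) + 1))ᶜ := by
  intro ω hω
  obtain ⟨b, hb, hωb⟩ := mem_exitEvent_iff.1 hω
  have hpath : PathIn LatticeModels.triGraph ω 0 b :=
    (PathIn.of_mem_siteConnIn hωb).mono Set.inter_subset_right
  obtain ⟨hbΛ, y, hy, hby⟩ := LatticeModels.mem_innerBoundary_iff.1 hb
  rw [LatticeModels.mem_box] at hbΛ
  rw [LatticeModels.mem_box, not_forall] at hy
  obtain ⟨i, hi⟩ := hy
  have hci := triGraph_adj_coord hby i
  have hbi := hbΛ i
  push_cast at hi hbi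
  -- `b` is far out: `|b i| ≥ 8^k`
  have hfar : (8 : ℤ) ^ k ≤ b i ∨ b i ≤ -(8 : ℤ) ^ k := by omega
  rw [Set.mem_preimage, Set.mem_iInter₂]
  intro j hj
  rw [Finset.mem_range] at hj
  rw [Set.mem_compl_iff]
  rintro ⟨⟨⟨hT, hB⟩, hR⟩, hL⟩
  rw [Set.mem_preimage, SiteConfig.relabel_apply, mem_brickHEvent] at hB hR hL
  rw [mem_brickHEvent] at hT
  refine not_pathIn_of_annulus (a := 8 ^ j) (ω := ω) (z := b) ?_ ?_ ?_ ?_ hpath ?_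
  · exact_mod_cast hT
  · exact_mod_cast hB
  · exact_mod_cast hR
  · exact_mod_cast hL
  · rw [Finset.mem_coe, LatticeModels.mem_box, not_forall]
    refine ⟨i, fun h => ?_⟩
    have hpow : (8 : ℤ) ^ (j + 1) ≤ 8 ^ k := pow_le_pow_right₀ (by norm_num) hj
    have h8 : (1 : ℤ) ≤ 8 ^ j := one_le_pow₀ (by norm_num)
    rw [pow_succ] at hpow
    push_cast at h
    omega

/-- **`θ(1/2) ≤ (1 - c⁴)^k` for every `k`**, `c = 4 · 8⁻¹⁶` (Werner 2009, Cor. 1.2: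
`P(0 ⟷ ∂Λ_{2^{l}}) ≤ (1 - a^6)^{l}` by independence of the annulus events; here
`θ(1/2) ≤ P_{1/2}(0 ⟷ ∂ⁱⁿΛ(8^k)) = P_{1/2}(ωᶜ exits Λ(8^k)) ≤ P_{1/2}(⋂_{j<k} A_{8^j}ᶜ) =
∏_{j<k} (1 - P_{1/2}(A_{8^j})) ≤ (1 - c⁴)^k`, using the symmetry `P_{1/2} ∘ compl⁻¹ = P_{1/2}`,
`exitEvent_subset_compl_preimage`, `real_biInter_compl_eq_prod` for the disjoint annuli
`Λ(6 · 8^j + 2) ∖ Λ(8^j)` and `le_real_annulusEvent`). [cite: Werner2009, Corollary 1.2] -/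
theorem triTheta_half_le_pow (k : ℕ) : LatticeModels.triTheta half ≤ (1 - (4 * (1 / 8 : ℝ) ^ 16) ^ 4) ^ k := by
  set c4 : ℝ := (4 * (1 / 8 : ℝ) ^ 16) ^ 4 with hc4
  -- the black four-strip events at the scales `8^j` and their supports
  set A : ℕ → Set (SiteConfig (LatticeModels.Site 2)) := fun j =>
    brickHEvent (-(9 * (8 ^ j : ℕ) + 3)) (9 * (8 ^ j : ℕ) + 3) ((8 ^ j : ℕ) + 1)
          (3 * (8 ^ j : ℕ) + 1) ∩
      SiteConfig.relabel (Equiv.neg (LatticeModels.Site 2)) ⁻¹'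
        brickHEvent (-(9 * (8 ^ j : ℕ) + 3)) (9 * (8 ^ j : ℕ) + 3) ((8 ^ j : ℕ) + 1)
          (3 * (8 ^ j : ℕ) + 1) ∩
      SiteConfig.relabel transposeIso.toEquiv ⁻¹'
        brickHEvent (-(9 * (8 ^ j : ℕ) + 3)) (9 * (8 ^ j : ℕ) + 3) ((8 ^ j : ℕ) + 1)
          (3 * (8 ^ j : ℕ) + 1) ∩
      SiteConfig.relabel ((Equiv.neg (LatticeModels.Site 2)).trans transposeIso.toEquiv) ⁻¹'
        brickHEvent (-(9 * (8 ^ j : ℕ) + 3)) (9 * (8 ^ j : ℕ) + 3) ((8 ^ j : ℕ) + 1)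
          (3 * (8 ^ j : ℕ) + 1) with hA
  set K : ℕ → Finset (LatticeModels.Site 2) := fun j => LatticeModels.box 2 (6 * 8 ^ j + 2) \ LatticeModels.box 2 (8 ^ j) with hK
  have hAK : ∀ j, DeterminedBy (A j) ↑(K j) := fun j => determinedBy_annulusEvent (8 ^ j)
  have hKK : ∀ i j, i < j → Disjoint (K i) (K j) := by
    intro i j hij
    rw [Finset.disjoint_left]
    intro z hzi hzj
    rw [hK, Finset.mem_sdiff, LatticeModels.mem_box] at hzi hzj
    have hpow : (8 : ℤ) ^ (i + 1) ≤ 8 ^ j := pow_le_pow_right₀ (by norm_num) hij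
    rw [pow_succ] at hpow
    refine hzj.2 (LatticeModels.mem_box.2 fun l => ?_)
    have h := hzi.1 l
    have h8 : (1 : ℤ) ≤ 8 ^ i := one_le_pow₀ (by norm_num)
    push_cast at h ⊢
    omega
  have hPA : ∀ j, c4 ≤ (sitePercolation (LatticeModels.Site 2) half).real (A j) := fun j =>
    le_real_annulusEvent (Nat.one_le_pow _ _ (by norm_num))
  -- θ(1/2) ≤ P(exit Λ(8^k)) ≤ P(compl ⁻¹' ⋂ (A j)ᶜ) = P(⋂ (A j)ᶜ) = ∏ (1 - P(A j)) ≤ (1 - c4)^k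
  have h0 : (0 : LatticeModels.Site 2) ∈ LatticeModels.box 2 (8 ^ k) := by rw [LatticeModels.mem_box]; intro i; simp
  calc LatticeModels.triTheta half
      = (LatticeModels.triSitePercolation half).real (sitePercolatesAt LatticeModels.triGraph 0) := LatticeModels.triTheta_eq half
    _ ≤ (LatticeModels.triSitePercolation half).real (exitEvent LatticeModels.triGraph (LatticeModels.box 2 (8 ^ k)) 0) :=
        measureReal_mono (sitePercolatesAt_subset_exitEvent h0) (measure_ne_top _ _)
    _ ≤ (LatticeModels.triSitePercolation half).real (compl ⁻¹' ⋂ j ∈ Finset.range k, (A j)ᶜ) :=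
        measureReal_mono (exitEvent_subset_compl_preimage k) (measure_ne_top _ _)
    _ = (sitePercolation (LatticeModels.Site 2) half).real (⋂ j ∈ Finset.range k, (A j)ᶜ) :=
        triSitePercolation_half_real_preimage_compl _
    _ = ∏ j ∈ Finset.range k, (1 - (sitePercolation (LatticeModels.Site 2) half).real (A j)) :=
        real_biInter_compl_eq_prod half hAK hKK k
    _ ≤ ∏ _j ∈ Finset.range k, (1 - c4) := by
        refine Finset.prod_le_prod (fun j _ => ?_) (fun j _ => ?_)
        · exact sub_nonneg.2 measureReal_le_one
        · linarith [hPA j]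
    _ = (1 - c4) ^ k := by rw [Finset.prod_const, Finset.card_range]

end Literature.Probability.Percolation

namespace Literature.Probability.Percolation

open LatticeModels

/-- **`θ^site_𝕋(1/2) = 0`: no percolation at criticality on the triangular lattice** (Kesten
1982, §3.4, Application (i), (3.67) with Thm. 3.1 (3.43), p. 53; Werner 2009, Cor. 1.2;
Grimmett 2018, Thm. 5.56). Discharge of the named fact `triTheta_half` (`BoxCrossing.lean`):
`0 ≤ θ(1/2) ≤ (1 - c⁴)^k → 0` (`triTheta_half_le_pow`). [cite: KestenPTM1982, §3.4 Application (i), (3.67) with Thm. 3.1 (3.43), p. 53] -/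
theorem triTheta_half_holds : triTheta_half := by
  have hc0 : (0 : ℝ) < (4 * (1 / 8 : ℝ) ^ 16) ^ 4 := by positivity
  have hc1 : (4 * (1 / 8 : ℝ) ^ 16) ^ 4 ≤ 1 := by norm_num
  have hlim : Tendsto (fun k : ℕ => (1 - (4 * (1 / 8 : ℝ) ^ 16) ^ 4) ^ k) atTop (𝓝 0) :=
    tendsto_pow_atTop_nhds_zero_of_lt_one (by linarith) (by linarith)
  have hle : triTheta half ≤ 0 := ge_of_tendsto' hlim triTheta_half_le_pow
  have hge : 0 ≤ triTheta half := by rw [triTheta_eq]; exact measureReal_nonneg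
  exact le_antisymm hle hge

/-- **`p_c^site(𝕋) = 1/2`** (Kesten 1982, §3.4, Application (i), (3.67), p. 53; Wierman 1981;
Bollobás–Riordan 2006, Ch. 5, Thm. 8; Grimmett 2018, Thm. 5.56). Discharge of the named fact
`triCriticalProb_eq_half` (`BoxCrossing.lean`): `p_c ≤ 1/2` by the sharpness of the phase
transition and the Hex lemma (`triCriticalProb_le_half`, `TriSharpness.lean`), `p_c ≥ 1/2` by
`θ(1/2) = 0` (`triTheta_half_holds`) and the monotonicity of `θ`
(`triCriticalProb_eq_half_of_triTheta_half`). [cite: KestenPTM1982, §3.4 Application (i), (3.67), p. 53] -/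
theorem triCriticalProb_eq_half_holds : triCriticalProb_eq_half :=
  triCriticalProb_eq_half_of_triTheta_half triTheta_half_holds

end Literature.Probability.Percolation

namespace Literature.Probability.Percolation

/-! ### From brick crossings to crossings of the parallelogram -/

/-- A horizontal crossing of a brick rectangle with fewer rows is a horizontal crossing of any
brick rectangle with the same columns and more rows. [cite: Grimmett2018, §5.5] -/
theorem BrickH.of_rows {B : Set (LatticeModels.Site 2)} {X₀ X₁ Y₀ Y₁ Y₀' Y₁' : ℤ} (h : BrickH B X₀ X₁ Y₀' Y₁')
    (h0 : Y₀ ≤ Y₀') (h1 : Y₁' ≤ Y₁) : BrickH B X₀ X₁ Y₀ Y₁ := by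
  obtain ⟨x, y, hx, hy, hxy⟩ := h
  refine ⟨x, y, hx, hy, hxy.mono ?_⟩
  rintro z ⟨hz, hzB⟩
  refine ⟨?_, hzB⟩
  rw [mem_brickRect] at hz ⊢
  exact ⟨hz.1, hz.2.1, h0.trans hz.2.2.1, hz.2.2.2.trans h1⟩

/-- **A black horizontal crossing of the brick rectangle `{0 ≤ X ≤ 2m + n} × {0 ≤ Y ≤ n}`
contains a left–right crossing of the parallelogram `R(m, n)`** (`m ≥ 1`): along the crossing
`x₀ = (X - Y)/2` starts `≤ 0`, ends `≥ m` and moves by at most `1` per step, so between its last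
visit to `{x₀ ≤ 0}` (on the left side `x₀ = 0`) and its next visit to `{x₀ ≥ m}` (on the right
side) the path stays in `R(m, n)`. (Grimmett 2018, proof of Lemma 5.22, read backwards.)
[cite: Grimmett2018, Lemma 5.22 (proof)] -/
theorem triLRCrossing_of_brickH {m n : ℕ} (hm : 1 ≤ m) {ω : SiteConfig (LatticeModels.Site 2)}
    (h : BrickH ω 0 (2 * m + n) 0 n) : ω ∈ Literature.Probability.Percolation.triLRCrossing m n := by
  obtain ⟨x, y, hx, hy, hxy⟩ := h
  have hxR := hxy.left_mem.1
  have hyR := hxy.right_mem.1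
  rw [mem_brickRect] at hxR hyR
  simp only [brickX] at hx hy hxR hyR
  -- last visit to `{x₀ ≤ 0}`
  have hx0 : x 0 ≤ 0 := by omega
  have hy0 : ¬ y 0 ≤ 0 := by omega
  obtain ⟨c, d, hcC, hcA, hdC, hcd, hdy⟩ :=
    hxy.last_exit (C := {z : LatticeModels.Site 2 | z 0 ≤ 0}) hx0 hy0
  simp only [Set.mem_setOf_eq, not_le] at hcC hdC
  have hc0 : c 0 = 0 := by
    have := (triGraph_adj_coord hcd 0).2
    omega
  -- the path from `c` on: `c ∼ d ⟶ y`, inside `{0 ≤ x₀}`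
  have hcy : PathIn LatticeModels.triGraph ((brickRect 0 (2 * m + n) 0 n ∩ ω) ∩ {z | 0 ≤ z 0}) c y := by
    have h1 : PathIn LatticeModels.triGraph ((brickRect 0 (2 * m + n) 0 n ∩ ω) ∩ {z | 0 ≤ z 0}) d y := by
      refine hdy.mono ?_
      rintro z ⟨hz, hzC⟩
      simp only [Set.mem_setOf_eq, not_le] at hzC
      exact ⟨hz, hzC.le⟩
    have hc : c ∈ (brickRect 0 (2 * m + n) 0 n ∩ ω) ∩ {z : LatticeModels.Site 2 | 0 ≤ z 0} :=
      ⟨hcA, by simp only [Set.mem_setOf_eq]; omega⟩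
    exact (PathIn.of_adj hc h1.left_mem hcd).trans h1
  -- first visit to `{x₀ ≥ m}`
  have hcRm : c ∈ {z : LatticeModels.Site 2 | z 0 < m} := by simp only [Set.mem_setOf_eq]; omega
  have hsub : {z : LatticeModels.Site 2 | z 0 < m} ∩ ((brickRect 0 (2 * m + n) 0 n ∩ ω) ∩ {z | 0 ≤ z 0}) ⊆
      ↑(rectangle m n) ∩ ω := by
    rintro z ⟨hz1, ⟨hzR, hzω⟩, hz2⟩
    simp only [Set.mem_setOf_eq] at hz1 hz2
    rw [mem_brickRect] at hzR
    refine ⟨Finset.mem_coe.2 (mem_rectangle_iff.2 ⟨hz2, by omega, hzR.2.2.1, hzR.2.2.2⟩), hzω⟩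
  have hcL : c ∈ leftSide m n := by
    have hcR := hcA.1; rw [mem_brickRect] at hcR
    exact Finset.mem_filter.2 ⟨mem_rectangle_iff.2 ⟨by omega, by omega, hcR.2.2.1, hcR.2.2.2⟩, hc0⟩
  rcases hcy.exit_or (R := {z : LatticeModels.Site 2 | z 0 < m}) hcRm with h2 | ⟨a', b', ha', hb', hb'A, hab', hca'⟩
  · have := h2.right_mem.1
    simp only [Set.mem_setOf_eq] at this
    omega
  · simp only [Set.mem_setOf_eq, not_lt] at ha' hb'
    have hb'0 : b' 0 = m := by have := (triGraph_adj_coord hab' 0).2; omega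
    have hb'R : b' ∈ rightSide m n := by
      have hbR := hb'A.1.1; rw [mem_brickRect] at hbR
      exact Finset.mem_filter.2 ⟨mem_rectangle_iff.2 ⟨by omega, by omega, hbR.2.2.1, hbR.2.2.2⟩,
        hb'0⟩
    refine Literature.Probability.Percolation.mem_triLRCrossing_iff.2 ⟨c, hcL, b', hb'R, PathIn.mem_siteConnIn ?_⟩
    exact (hca'.mono hsub).tail hab' ⟨Finset.mem_coe.2 (Finset.mem_filter.1 hb'R).1, hb'A.1.2⟩

/-- `P_p(H({0 ≤ X ≤ 2m + n} × {0 ≤ Y ≤ n})) ≤ P_p(LR_𝕋(m, n))` for `m ≥ 1`.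
[cite: Grimmett2018, Lemma 5.22 (proof)] -/
theorem brickHProb_le_triLRCrossingProb (p : unitInterval) {m n : ℕ} (hm : 1 ≤ m) :
    brickHProb p 0 (2 * m + n) 0 n ≤ Literature.Probability.Percolation.triLRCrossingProb p m n :=
  measureReal_mono (fun _ hω => triLRCrossing_of_brickH hm hω) (measure_ne_top _ _)

/-! ### The generic lower bound -/

/-- **RSW lower bound for parallelograms**: for `1 ≤ m ≤ K n` and `n ≥ 2`,
`P_{1/2}(LR_𝕋(m, n)) ≥ 4 · 8^{-2^{K+3}}`. With `a = ⌊n/2⌋ ≥ 1`, the brick rectangle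
`{1 ≤ X ≤ 2^{K+4} a} × {1 ≤ Y ≤ 2a + 1}` is crossed horizontally with probability
`≥ 4 · 8^{-2^{K+3}}` (`rsw_iterate`); translate it by `(0, -1)` (`X ↦ X - 1`, `Y ↦ Y - 1`),
narrow it to `{0 ≤ X ≤ 2m + n}` (`2m + n ≤ 2^{K+4} a - 1`) and heighten it to `{0 ≤ Y ≤ n}`.
(Werner 2009, Cor. 1.1; Grimmett 2018, Thm. 5.23.) [cite: Grimmett2018, Theorem 5.23] -/
theorem le_triLRCrossingProb (K : ℕ) {m n : ℕ} (hm : 1 ≤ m) (hn : 2 ≤ n) (hK : m ≤ K * n) :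
    4 * (1 / 8 : ℝ) ^ (2 ^ (K + 3)) ≤ Literature.Probability.Percolation.triLRCrossingProb half m n := by
  set a : ℕ := n / 2 with ha
  have ha1 : 1 ≤ a := by omega
  have ha2 : 2 * a ≤ n := by omega
  have ha3 : n ≤ 2 * a + 1 := by omega
  -- width bookkeeping: `2m + n ≤ 2^{K+4} a - 1`
  have hpow : (2 : ℕ) * K + 2 ≤ 2 ^ (K + 2) := by
    have h1 : K < 2 ^ K := Nat.lt_two_pow_self
    have h2 : 2 ^ (K + 2) = 2 ^ K * 4 := by rw [pow_add]; norm_num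
    omega
  set P : ℕ := 2 ^ (K + 2) with hP
  have hP3 : 2 ^ (K + 3) = 2 * P := by rw [hP, pow_succ]; ring
  have hwidth : 2 * m + n + 1 ≤ 2 * (2 ^ (K + 3) * a) := by
    have e1 : (2 * K + 2) * n = 2 * (K * n) + 2 * n := by ring
    have h2 : (2 * K + 2) * n ≤ P * n := Nat.mul_le_mul_right n hpow
    have h3 : P * n ≤ P * (2 * a + 1) := Nat.mul_le_mul_left _ ha3
    have e3 : P * (2 * a + 1) = 2 * (P * a) + P := by ring
    have hq : P ≤ P * a := Nat.le_mul_of_pos_right _ ha1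
    have e4 : 2 * (2 ^ (K + 3) * a) = 4 * (P * a) := by rw [hP3]; ring
    rw [e4]
    rw [e1] at h2
    rw [e3] at h3
    omega
  have hwidthZ : (2 * m + n + 1 : ℤ) ≤ 2 * (2 ^ (K + 3) * a) := by exact_mod_cast hwidth
  have h1 := SmirnovRSW.rsw_iterate (a := a) (K + 3) ha1
  have h2 := brickHProb_shift half ![(0 : ℤ), -1] 1 (2 * (2 ^ (K + 3) * a)) 1 (2 * a + 1)
  have hX : brickX ![(0 : ℤ), -1] = -1 := by simp [brickX]
  have hY : (![(0 : ℤ), -1] : LatticeModels.Site 2) 1 = -1 := rfl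
  rw [hX, hY] at h2
  have e1 : (1 : ℤ) + -1 = 0 := by norm_num
  have e2 : (2 * a + 1 : ℤ) + -1 = 2 * a := by ring
  rw [e1, e2] at h2
  calc 4 * (1 / 8 : ℝ) ^ 2 ^ (K + 3) ≤ _ := h1
    _ = _ := h2.symm
    _ ≤ brickHProb half 0 (2 * m + n) 0 (2 * a) :=
        brickHProb_antitone half le_rfl (by push_cast; omega) (by omega)
    _ ≤ brickHProb half 0 (2 * m + n) 0 n :=
        measureReal_mono (fun _ hω => BrickH.of_rows hω le_rfl (by omega))
          (measure_ne_top _ _)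
    _ ≤ Literature.Probability.Percolation.triLRCrossingProb half m n := by
        exact_mod_cast brickHProb_le_triLRCrossingProb half (n := n) hm

/-! ### Duality and positivity -/

/-- **Duality at `p = 1/2`**: `P_{1/2}(LR_𝕋(m, n)) = 1 - P_{1/2}(LR_𝕋(n, m))`
(`triLRCrossingProb_add_eq_one`). [cite: BollobasRiordan2006, Ch. 5 Lemma 7] -/
theorem triLRCrossingProb_half_eq_one_sub (m n : ℕ) :
    Literature.Probability.Percolation.triLRCrossingProb half m n = 1 - Literature.Probability.Percolation.triLRCrossingProb half n m := by
  have h := triLRCrossingProb_add_eq_one half m n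
  have hs : unitInterval.symm half = half := Subtype.ext (by simp [half]; norm_num)
  rw [hs] at h
  linarith

/-- **Crossing probabilities are positive**: `P_p(LR_𝕋(m, n)) ≥ p^{|R(m, n)|}`, since the
parallelogram is crossed along its bottom row when all its sites are open. [folklore] -/
theorem pow_le_triLRCrossingProb (p : unitInterval) (m n : ℕ) :
    (p : ℝ) ^ (rectangle m n).card ≤ Literature.Probability.Percolation.triLRCrossingProb p m n := by
  rw [← sitePercolation_real_subset p (rectangle m n)]
  refine measureReal_mono (fun ω hω => ?_) (measure_ne_top _ _)
  have hω : (↑(rectangle m n) : Set (LatticeModels.Site 2)) ⊆ ω := hω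
  have hrow : ∀ j : ℕ, j ≤ m →
      (0 : LatticeModels.Site 2) + (j : ℤ) • triE0 ∈ (↑(rectangle m n) : Set (LatticeModels.Site 2)) ∩ ω := by
    intro j hj
    have : (0 : LatticeModels.Site 2) + (j : ℤ) • triE0 ∈ (↑(rectangle m n) : Set (LatticeModels.Site 2)) := by
      rw [Finset.mem_coe, mem_rectangle_iff, add_zsmul_triE0_apply_zero,
        add_zsmul_triE0_apply_one, Pi.zero_apply, Pi.zero_apply]
      omega
    exact ⟨this, hω this⟩
  have hpath := triPathIn_row_right (A := (↑(rectangle m n) : Set (LatticeModels.Site 2)) ∩ ω) (a := 0) m hrow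
  have h0 := (hrow 0 (Nat.zero_le _)).1
  simp only [Nat.cast_zero, zero_smul, add_zero, Finset.mem_coe] at h0
  have hm' : (0 : LatticeModels.Site 2) + (m : ℤ) • triE0 ∈ rectangle m n := Finset.mem_coe.1 (hrow m le_rfl).1
  refine Literature.Probability.Percolation.mem_triLRCrossing_iff.2 ⟨0, Finset.mem_filter.2 ⟨h0, rfl⟩,
    (0 : LatticeModels.Site 2) + (m : ℤ) • triE0, Finset.mem_filter.2 ⟨hm', ?_⟩, hpath.mem_siteConnIn⟩
  rw [add_zsmul_triE0_apply_zero, Pi.zero_apply, zero_add]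

/-- `P_p(LR_𝕋(m, n)) > 0` for `p > 0`. [folklore] -/
theorem triLRCrossingProb_pos {p : unitInterval} (hp : 0 < (p : ℝ)) (m n : ℕ) :
    0 < Literature.Probability.Percolation.triLRCrossingProb p m n :=
  (pow_pos hp _).trans_le (pow_le_triLRCrossingProb p m n)

end Literature.Probability.Percolation

namespace Literature.Probability.Percolation

open LatticeModels

/-- **The RSW box-crossing property on `𝕋` at `p = 1/2`** (Kesten 1982, §3.4; Russo 1981;
Werner 2009, Cor. 1.1; Grimmett 2018, Thm. 5.23). Discharge of the named fact `tri_rsw_half`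
(`BoxCrossing.lean`): for `n ≥ 2` and `m = ⌊ρ n⌋ ≥ 2` the two bounds are `le_triLRCrossingProb`
with `K = ⌈ρ⌉` (for `m ≤ K n`) and, through the duality `triLRCrossingProb_half_eq_one_sub`,
with `K' = ⌈2/ρ⌉` (for `n ≤ K' m`, as `m ≥ ρ n - 1 ≥ ρ n / 2`); the finitely many `n` with
`n ≤ 1` or `m ≤ 1` (all `≤ 2/ρ + 2`) are absorbed by `triLRCrossingProb_pos` and a finite
minimum. [cite: KestenPTM1982, §3.4] -/
theorem tri_rsw_half_holds : tri_rsw_half := by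
  intro ρ hρ
  -- generic constants
  set K : ℕ := ⌈ρ⌉₊ with hK
  set K' : ℕ := ⌈2 / ρ⌉₊ with hK'
  set c₁ : ℝ := 4 * (1 / 8 : ℝ) ^ (2 ^ (K + 3)) with hc₁
  set c₂ : ℝ := 4 * (1 / 8 : ℝ) ^ (2 ^ (K' + 3)) with hc₂
  -- small cases: `n ≤ N₀`
  set N₀ : ℕ := K' + 2 with hN₀
  set f : ℕ → ℝ := fun n =>
    min (triLRCrossingProb half ⌊ρ * n⌋₊ n) (1 - triLRCrossingProb half ⌊ρ * n⌋₊ n) with hf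
  have hfpos : ∀ n, 0 < f n := by
    intro n
    have hhalf : 0 < ((half : unitInterval) : ℝ) := by simp [half]
    refine lt_min (triLRCrossingProb_pos hhalf _ _) ?_
    rw [triLRCrossingProb_half_eq_one_sub, sub_sub_cancel]
    exact triLRCrossingProb_pos hhalf _ _
  obtain ⟨n₀, hn₀mem, hn₀⟩ :=
    (Finset.range (N₀ + 1)).exists_min_image f ⟨0, by simp⟩
  set c₃ : ℝ := f n₀ with hc₃
  refine ⟨min (min c₁ c₂) c₃, lt_min (lt_min (by positivity) (by positivity)) (hfpos n₀), ?_⟩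
  intro n hmn
  set m : ℕ := ⌊ρ * n⌋₊ with hm
  by_cases hsmall : n ≤ N₀
  · -- small `n`: the finite minimum
    have hle : c₃ ≤ f n := hn₀ n (Finset.mem_range.2 (Nat.lt_succ_of_le hsmall))
    constructor
    · exact (min_le_right _ _).trans (hle.trans (min_le_left _ _))
    · have := hle.trans (min_le_right _ _)
      have h3 : min (min c₁ c₂) c₃ ≤ c₃ := min_le_right _ _
      linarith
  · -- generic `n`: `n ≥ K' + 3 ≥ 3`, `m ≥ 2`
    have hsmall : N₀ < n := not_le.1 hsmall
    have hn2 : 2 ≤ n := by omega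
    have hρn : (m : ℝ) ≤ ρ * n := Nat.floor_le (by positivity)
    have hρn' : ρ * n < m + 1 := Nat.lt_floor_add_one _
    have hKρ : ρ ≤ K := Nat.le_ceil ρ
    have hK'ρ : 2 / ρ ≤ K' := Nat.le_ceil _
    -- `m ≤ K n`
    have hmK : m ≤ K * n := by
      have : (m : ℝ) ≤ K * n := hρn.trans (by gcongr)
      exact_mod_cast this
    -- `n ≤ K' m` and `m ≥ 2`: from `n > K' + 2 ≥ 2/ρ + 2`, `ρ n > 2 + 2ρ`, so `m > 1 + 2ρ ≥ 1`…
    have hn_real : (2 / ρ + 2 : ℝ) < n := by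
      have : ((K' + 2 : ℕ) : ℝ) < n := by exact_mod_cast hsmall
      push_cast at this
      linarith
    have hρn2 : 2 + 2 * ρ < ρ * n := by
      have := mul_lt_mul_of_pos_left hn_real hρ
      rw [mul_add, mul_div_cancel₀ _ hρ.ne'] at this
      linarith
    have hm2 : 2 ≤ m := by
      have : (1 : ℝ) < m := by linarith
      have : 1 < m := by exact_mod_cast this
      omega
    have hnK' : n ≤ K' * m := by
      -- `n = (2/ρ) (ρ n / 2) ≤ (2/ρ) m ≤ K' m`, using `m ≥ ρ n - 1 ≥ ρ n / 2`
      have h1 : ρ * n / 2 ≤ m := by linarith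
      have h2 : (n : ℝ) ≤ 2 / ρ * m := by
        rw [div_mul_eq_mul_div, le_div_iff₀ hρ]
        linarith
      have h3 : (n : ℝ) ≤ K' * m := h2.trans (by gcongr)
      exact_mod_cast h3
    have hlow : c₁ ≤ triLRCrossingProb half m n := le_triLRCrossingProb K (by omega) hn2 hmK
    have hlow' : c₂ ≤ triLRCrossingProb half n m := le_triLRCrossingProb K' (by omega) hm2 hnK'
    constructor
    · exact (min_le_left _ _).trans ((min_le_left _ _).trans hlow)
    · rw [triLRCrossingProb_half_eq_one_sub]
      have : min (min c₁ c₂) c₃ ≤ c₂ := (min_le_left _ _).trans (min_le_right _ _)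
      linarith

end Literature.Probability.Percolation
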